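import Literature.MathematicalPhysics.QuantumFieldTheory.Balaban1983to89.B9Thm34SectBUniform

/-!
# `Balaban1983to89.B9Thm34InvBlk` — [Balaban1985BackgroundPropagators] p. 403 (3.65)–(3.67) «The inverse satisfies Theorem 3.2» and
# the `(Q′G′²Q′*)⁻¹(U′U)`-clause of THEOREM 3.4 p. 400, RE-TYPED ON A GENERAL BLOCK CARRIER `(P, blkP : P → 𝔅)` for the functions on 𝔅
# (so that 𝔤-valued block functions `𝔅 × ι′ → ℝ`, block map `Prod.fst`, instantiate it) — repair item R-Ker-1 of cell `lit-balaban`, seat r06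
# gen 68 (append-only sibling of r06 gen 1 `B9Thm34Inv`, gen 6 `B9Ineq366CPrime` §6, gen 9 `B9Ineq366Vprime`, gen 20 `B9Thm34SectBUniform(R1)` §2)

statement-level skeleton of published theorems with citation tags; proofs where landed; nothing here is a claim about the Yang–Mills mass gap

CITATION HEADER (lean-in-tree rule).  B9 = T. Bałaban, *Propagators for lattice gauge theories in a background field*, Commun. Math. Phys.
**99** (1985) 389–434 [Balaban1985BackgroundPropagators] (held `paper:balaban1985-cmp99-background-propagators`; journal page = PDF page + 388):
p. 403 [PDF 15] l.1–16, verbatim (render `…-p015-x2.png`, re-read by the r06 lineage 2026-08-21/22, LEDGER §10): «Let us consider the operator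
(Q′(U)G′²(U)Q′*(U))⁻¹. Its inverse can be analytically continued to configurations U′U and has the expansion Q′(U′U)G′²(U′U)Q′*(U′U) =
Q′(U)G′²(U)Q′*(U) + F′₂(A)G′²(U′U)Q′*(U) + Q′(U)G′²(U′U)F′₂*(A) + F′₂(A)G′²(U′U)F′₂*(A) + Q′(U)G′(U′U)V′(A)G′²(U)Q′*(U) +
Q′(U)G′²(U)V′(A)G′(U′U)Q′*(U) + Q′(U)G′(U)V′(A)G′²(U′U)V′(A)G′(U)Q′*(U) = Q′(U)G′²(U)Q′*(U) + C′(A), (3.65) where the operator C′(A) is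
defined by the last equality. Using the results obtained for operators building it, and Lemma 2.1 [4], in the same way as in the bounds (2.68)
in [4], we get |C′(A; y, y′)| ≦ O(1)α₁(Lʲη)⁴(L^{j′}η)^{−d}e^{−(1/2)δ₀d(y,y′)} for y ∈ Λ_j, y′ ∈ Λ_{j′}. (3.66) Using Theorem 3.2 and the above
bound we obtain Q′(U′U)G′²(U′U)Q′*(U′U) = (I + C′(A)(Q′(U)G′²(U)Q′*(U))⁻¹)·Q′(U)G′²(U)Q′*(U), |C′(A)(Q′(U)G′²(U)Q′*(Q))⁻¹)(y, y′)| ≦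
O(1)α₁(L^{j′}η)^{−d}e^{−(1/2)δ₀d(y,y′)}, (3.67) thus the operators in the equality are invertible and an inverse of the left-hand side can be
expressed by a Neumann series convergent for α₁ sufficiently small. Each term of the series is an analytic function of A on the domain (3.37).
The inverse satisfies Theorem 3.2.»; Theorem 3.2 (3.48) p. 398 [PDF 10] «|(Q′(U)G′²(U)Q′*(U))⁻¹(y, y′)| ≦ B₀(Lʲη)^{−4}(L^{j′}η)^{−d}
e^{−δ₀d(y,y′)}, y, y′ ∈ 𝔅»; Theorem 3.4 p. 400 [PDF 12] l.7–10 «There exists a positive constant a₁ such that the operators G′(U),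
(Q′(U)G′²(U)Q′*(U))⁻¹, R(U), G(U) extend to configurations U′U for α₁ ≦ a₁ as analytic functions of A. The extended operators satisfy all
the inequalities of Theorems 3.1–3.3 correspondingly»; p. 399 [PDF 11] l.1–3 «the constants in the formulations of both theorems do not
depend on the sequence {Ω_j}»; (3.8) p. 392 [PDF 4] (the averaging operators act on 𝔤-VALUED functions: «functions on T₁^{(j)} with values
in 𝔤»), (3.19)/(3.21) pp. 393–394, (3.57)–(3.64) pp. 401–402, Thm 3.1 (3.42) p. 397, (3.37) p. 396, p. 398 remark after (3.47) «Using
Lemma 2.1 in [4] we may replace the factor (Lʲη)^α by (Lʲη)^β(L^{j′}η)^γ with β + γ = α».  [4] = [Balaban1984PropagatorsII] (CMP **96**):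
Lemma 2.1 p. 234 [PDF 12] ((2.60)–(2.61)), (2.51)–(2.55) p. 232 («|(Tλ)(x)| ≦ K(y, y′)|λ|, x ∈ B^j(y), supp λ ⊂ B^{j′}(y′)» and «this
property is preserved under the composition of operators possessing it»), (2.66) p. 234, (2.68) p. 235.  Rows B9.Thm3.4 × B9.Thm3.2 ×
B9.Eq3.66 × B9.Eq3.65 (cells only; no row head changes).

WHY THIS FILE (R-Ker-1; INTERFACES-r06 §111; pub-ymgap dag-n06-c LOCATED-10, 2026-08-28T10:55Z; lit-balaban lead g32 RULING #6 (A)(3),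
2026-08-28T11:20Z).  r06 gen 1's `B9Thm34Inv` types the operators of the p. 403 display — `L = Q′G′²Q′*`, its inverse `C⁻¹(U)`, `L′`,
`C′(A)` — as `Module.End ℝ (g.Site → ℝ)`: REAL SCALAR functions on the block set 𝔅, block map = identity (`hasMajorant_id_iff`), and so do
all its consumers (`B9Ineq366CPrime` §4–§6, `B9Ineq366Vprime` §3, FILES 26/45 `thm34_Cinv_final` / `thm34_Cinv_uniform` and the R1 sibling:
`{Qc : (S × ι → ℝ) →ₗ[ℝ] (g.Site → ℝ)} … {Linv : Module.End ℝ (g.Site → ℝ)}`).  In print the averaged fields are 𝔤-VALUED ((3.8) p. 392),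
so `C(U) = Q′G′²Q′*` acts on functions `𝔅 → 𝔤`; the pub-ymgap N06 record types them as `BlkY → 𝔸`, in real coordinates
`BlkY × ι → ℝ` (node00-def-Y's `CY parS Gp U = XinvY ∘ₗ liftMatY (diagonal cWtY)`), which the scalar clause cannot instantiate whenever
`dim_ℝ 𝔸 > 1` (dag-n06-c OBS-2 / LOCATED-10: `CinvFrame₂.reg_cinv` / `cop_eq` unreachable).  THIS FILE re-threads the whole `C⁻¹(U′U)` chain
ON AN ARBITRARY FINITE BLOCK CARRIER `P` with block map `blkP : P → 𝔅` — the functions on 𝔅 with values in ANY finite-dimensional real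
space (`P = 𝔅 × ι′`, `blkP = Prod.fst`), or any refinement of 𝔅 — using [4] (2.51)'s block-majorant notion `B6RandomWalk.HasMajorant blkP`
throughout, which is carrier-generic in the tree already (`hasMajorant_mul`, `majorant_of_fixedPoint_266`, `hasMajorant_cPrime`,
`hasMajorant_cornerR`, `hasMajorant_emb`, `eq365b_hom`, `isUnit_one_add_of_rowSum`, `factor_367`, `fixedPoint_of_inverse`).  NOTHING
existing is edited; the scalar clause and its consumers stay valid (it is the case `P = 𝔅`, `blkP = id`).

THE ONE NEW OBSERVATION (the dictionary, §1).  For a general block carrier the (2.51)-majorant statement «|(Tμ)(p)| ≦ K(y, y′)·sup|μ| for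
p over y, supp μ over y′» is EQUIVALENT to the bound `Σ_{p′ over y′} |T(δ_{p′})(p)| ≦ K(y, y′)` on the ℓ¹-ROW SUMS OF THE BLOCK of the
matrix of `T` between the fibres over `y` and `y′` (`hasMajorant_blk_iff`; for `blkP = id` this is r06 gen 1's `hasMajorant_id_iff`).
Consequently the total row sums `Σ_{p′} |T(δ_{p′})(p)|` of an operator with majorant `θe^{−r d(y,y′)}` are `≦ θc₁(r, α′)` by [4] (2.61)
EXACTLY as in the scalar case (`rowSum_le_of_majorant_blk`) — NO multiplicity factor `|ι′|` enters the invertibility step «thus the operators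
in the equality are invertible» (`isUnit_ext_blk`, maximum principle on the finite set `P`), and the constants and the threshold `a₁` of the
clause are LITERALLY those of the scalar clause.  (A multiplicity / basis constant appears only if one insists on ENTRYWISE bounds
`|T(δ_{p′})(p)| ≦ K` on `𝔅 × ι′`: `hasMajorant_blk_of_entry_le` displays the factor `N ≧ #fibre`, `entry_le_of_hasMajorant_blk` the converse
without factor.)

WHAT IS PROVED (0 `def`, 0 sorry, 0 new named facts; standard axioms).
* §1 (the device of `B9Thm34Inv` on `(P, blkP)`): `hasMajorant_blk_iff`, `entry_le_of_hasMajorant_blk`, `hasMajorant_blk_of_entry_le`,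
  `hasMajorant_fst_of_entry_le` (`P = 𝔅 × ι′`), `hasMajorant_neg_blk`, `rowSum_le_of_majorant_blk` ((2.61)), `ineq367_of_366_348_blk`
  ((3.66) + (3.48) + Lemma 2.1 ⟹ (3.67) with `θ = κB₀Cc₁(½+α)·α₁`, rate `(½−α)δ₀` — gen 1's route verbatim), `isUnit_ext_blk` («thus the
  operators in the equality are invertible»), `inv_majorant_of_367_blk` ([4] (2.66) for the fixed point `T = C⁻¹ − T·E`),
  ★ `inverse_satisfies_thm32_blk` («The inverse satisfies Theorem 3.2» with `B₁′ = 2B₀c₁((½−α)δ₀, α′)`, `δ₁′ = (1−α′)(½−α)δ₀` and the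
  explicit threshold `α₁ ≦ (2κB₀Cc₁(δ₀,½+α)c₁((½−α)δ₀,α′))⁻¹` — hypotheses (3.48) for `C⁻¹(U)`, (3.65), (3.66) for `C′(A)` and the conclusion
  ALL in the block-majorant form `HasMajorant blkP · (B·(Lʲη)^{∓4}·e^{−δ d(y,y′)})`, the pairing factor `(L^{j′}η)^{−d}` of the printed
  kernels absorbed as in `B9Thm34Inv`'s dictionary `ker_le_iff`).
* §2 `hasMajorant_cPrimeHom_blk` — (3.66) for the printed six-term sum `C′(A)` (`B9Ineq366CPrime.cPrimeHom`) built from TWO-SPACE letters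
  `Q′, F′₂ : (X → ℝ) →ₗ (P → ℝ)`, `Q′*, F′₂* : (P → ℝ) →ₗ (X → ℝ)` with block-diagonal majorants `κ_Q𝟙`, `c_Fα₁𝟙` and site operators `G′(U)`,
  `G′(U′U)`, `V′` with (3.42)₁/(3.63)-shaped majorants: majorant `κ₃₆₆α₁(Lʲη)⁴e^{−ρ d}` for the block map `blkP` (gen 6's
  `hasMajorant_cPrimeHom` is the case `blkP = id`; same proof: embed in `X ⊕ P`, `hasMajorant_cPrime`, take the corner).
* §3 `hasMajorant_cPrimeHom_vPrime_blk`, ★ `inverse_satisfies_thm32_vPrime_blk` — gen 9's `B9Ineq366Vprime` §2–§3 (the CONCRETE `V′(A)` of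
  (3.60) and the concrete `G′(U′U)` of (3.64)) with the block functions on `(P, blkP)`; proofs verbatim with §1–§2 in place of the scalar device.
* §4 ★ `thm34_Cinv_uniform_blk` — THEOREM 3.4's `(Q′G′²Q′*)⁻¹(U′U)`-clause with the threshold `a₁` chosen BEFORE the lattice, = FILE 45-R1
  `B9Thm34SectBUniformR1.thm34_Cinv_uniform` with `{P} (blkP : P → 𝔅) {Qc : (S × ι → ℝ) →ₗ[ℝ] (P → ℝ)} {Qcs : (P → ℝ) →ₗ[ℝ] (S × ι → ℝ)}
  {Linv : Module.End ℝ (P → ℝ)}`, the (3.19)/(3.59) letters as `HasMajorantHom (blk ∘ Prod.fst) blkP` / `HasMajorantHom blkP (blk ∘ Prod.fst)`,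
  Theorem 3.2 (3.48) for `U` and the conclusion for `U′U` as `HasMajorant blkP`; SAME constant `2B₁c₁(2δ₀/5, 1/10)`, SAME rate `9δ₀/25`,
  SAME `a₁` (the R1 exponent window `9/5000 ≦ α < 1` for [4] Lemma 2.1; the `0 < α` form implies it).  `thm34_Cinv_uniform_blk_pos` = the
  same with the «every `0 < α < 1`» binders of FILE 45, by restriction.

HONEST SCOPE / NOT CLAIMED.  As `B9Thm34Inv` / `B9Ineq366Vprime` / FILE 45: Theorem 3.1 for `G′(U)` and Theorem 3.2 for `U` are INPUTS
(p. 402 l.23, p. 403 l.10); (3.37) blockwise; the two-space letters with block-diagonal majorant hypotheses of the (3.19)/(3.59) shape; the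
rate `½δ₀` of (3.67) comes out as `(½−α)δ₀` (G-B9-21, «of course with different constants», p. 403 l.5–7); analyticity in `A` not treated;
real block-sup model.  The block carrier `P` is abstract: the identification `P = BlkY × ι`, `blkP = Prod.fst` (or the member block map) with
the record's `CY` is the CONSUMER's instantiation (dag-n06-c `CinvFrame₃`), not asserted here.  Value = the clause made instantiable at
vector-valued block functions; NOT a node discharge; nothing continuum / OS / mass-gap / Clay.

RELATED IN THE TREE, NOT DUPLICATED (searched 2026-08-28: `rg 'InvBlk|Cinv_uniform_blk|hasMajorant_blk_iff' lean/Literature` = ∅): `B9Thm34Inv`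
(scalar carrier; its carrier-generic lemmas USED BY NAME), `B9Ineq366CPrime` (§1–§4 generic, USED; §6 = the `blkP = id` case of §2 here),
`B9Ineq366Vprime` (§1 `eq365b_hom` generic, USED; §2–§3 = the `blkP = id` case of §3 here), `B9Thm34SectBUniform(R1)` §2 (= the `blkP = id`
case of §4), `B6RandomWalk` / `B6RandomWalkHom` (pv08's block-majorant calculus, USED); no existing module modified.
-/

noncomputable section

namespace Literature.MathematicalPhysics.QuantumFieldTheory.Balaban1983to89.B9Thm34InvBlk

open NormedSpace Complex
open Literature.MathematicalPhysics.QuantumFieldTheory.Balaban1983to89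
open Literature.MathematicalPhysics.QuantumFieldTheory.Balaban1983to89.B6RandomWalk (HasMajorant BlockSupp hasMajorant_mono hasMajorant_mul
  hasMajorant_zero Triangle254 Ineq261 c1_nonneg majorant_of_fixedPoint_266)
open Literature.MathematicalPhysics.QuantumFieldTheory.Balaban1983to89.B6RandomWalkHom (HasMajorantHom hasMajorantHom_mono hasMajorantHom_zero
  hasMajorant_emb hasMajorant_embL_right)
open Literature.MathematicalPhysics.QuantumFieldTheory.Balaban1983to89.B9Thm34Ext (toB6)
open Literature.MathematicalPhysics.QuantumFieldTheory.Balaban1983to89.B9Ineq347 (ScaleTransfer)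
open Literature.MathematicalPhysics.QuantumFieldTheory.Balaban1983to89.B9Thm34Inv (entry entry_neg apply_eq_sum_entry isUnit_one_add_of_rowSum
  factor_367 fixedPoint_of_inverse)
open Literature.MathematicalPhysics.QuantumFieldTheory.Balaban1983to89.B9Ineq366CPrime (cornerR cPrimeHom kappa366 kappa366_nonneg kappa366_pos
  hasMajorant_cPrime hasMajorant_cornerR cornerR_cPrime_emb hasMajorant_rate_mono)
open Literature.MathematicalPhysics.QuantumFieldTheory.Balaban1983to89.B9Ineq385VG (kappa385 kappa385_nonneg)
open Literature.MathematicalPhysics.QuantumFieldTheory.Balaban1983to89.B9Eq39Adjoint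
open Literature.MathematicalPhysics.QuantumFieldTheory.Balaban1983to89.B9Eq352DivForm (tauF tauB)
open Literature.MathematicalPhysics.QuantumFieldTheory.Balaban1983to89.B9Eq352DivFormLetters
open Literature.MathematicalPhysics.QuantumFieldTheory.Balaban1983to89.B9Eq352GradLetters (diffLetter)
open Literature.MathematicalPhysics.QuantumFieldTheory.Balaban1983to89.B9Eq360Vprime (gPrimeExtEnd eq365_end_left eq365_end
  opNorm_lt_one_of_363_261)
open Literature.MathematicalPhysics.QuantumFieldTheory.Balaban1983to89.B9Eq360VprimeLetters (vPrimeConc cBConc cCConc)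
open Literature.MathematicalPhysics.QuantumFieldTheory.Balaban1983to89.B9Ineq363Vprime (cVConc cVConc_nonneg theta363 theta363_nonneg
  ineq363_op_vPrime gpExt_entry1_vPrime hasMajorant_vPrime_gpExt)
open Literature.MathematicalPhysics.QuantumFieldTheory.Balaban1983to89.B9Ineq366Vprime (eq365b_hom theta363_eq_cV)
open Literature.MathematicalPhysics.QuantumFieldTheory.Balaban1983to89.B9Thm34GFinal (ineq261_rescale scaleTransfer_rescale
  c1_pos_of_ineq261 exists_threshold_of_continuousAt neumann_le_two)

/-! ## §1  The (3.65)–(3.67) device on a general block carrier `(P, blkP : P → 𝔅)` -/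

section Device

variable {g : B9.Geometry} [Fintype g.Site] [DecidableEq g.Site] {R : ℝ} {H : Prop}
variable {P : Type} [Fintype P] [DecidableEq P]

/-- **The dictionary** between pv08's block majorants of [4] (2.51) — «|(Tλ)(x)| ≦ K(y, y′)|λ|, x ∈ B^j(y), supp λ ⊂ B^{j′}(y′)» — for an
operator on the functions on a finite block carrier `P` (block map `blkP : P → 𝔅`) and its matrix: `T` has the majorant `K` iff for every
`p ∈ P` and every block `y′` the ℓ¹-row sum of the matrix block of `T` between `p` and the fibre over `y′` is at most `K(blkP p, y′)`.  For
`P = 𝔅`, `blkP = id` the fibre is `{y′}` and this is r06 gen 1's `B9Thm34Inv.hasMajorant_id_iff`.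
[cite: Balaban1984PropagatorsII, (2.51) p.232; Balaban1985BackgroundPropagators, (3.48) p.398] -/
theorem hasMajorant_blk_iff (blkP : P → g.Site) (T : Module.End ℝ (P → ℝ)) (K : g.Site → g.Site → ℝ) :
    HasMajorant (g := toB6 g R H) blkP T K ↔
      ∀ (p : P) (y' : g.Site), ∑ p' ∈ Finset.univ.filter (fun p' => blkP p' = y'), |entry T p p'| ≤ K (blkP p) y' := by
  constructor
  · intro h p y'
    -- test function: the sign pattern of the row of `T` on the fibre over `y′`
    set μ : P → ℝ := fun p' => if blkP p' = y' then (if 0 ≤ entry T p p' then 1 else -1) else 0 with hμdef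
    have hμs : BlockSupp (g := toB6 g R H) blkP μ y' 1 := by
      refine ⟨zero_le_one, fun p' (hp' : blkP p' = y') => ?_, fun p' (hp' : blkP p' ≠ y') => ?_⟩
      · simp only [hμdef, hp', if_true]
        split_ifs <;> simp
      · simp [hμdef, hp']
    have hT : T μ p = ∑ p' ∈ Finset.univ.filter (fun p' => blkP p' = y'), |entry T p p'| := by
      rw [apply_eq_sum_entry, ← Finset.sum_filter_add_sum_filter_not Finset.univ (fun p' => blkP p' = y')]
      have h0 : ∑ p' ∈ Finset.univ.filter (fun p' => ¬ blkP p' = y'), entry T p p' * μ p' = 0 :=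
        Finset.sum_eq_zero fun p' hp' => by
          have hne : blkP p' ≠ y' := (Finset.mem_filter.mp hp').2
          simp [hμdef, hne]
      rw [h0, add_zero]
      refine Finset.sum_congr rfl fun p' hp' => ?_
      have heq : blkP p' = y' := (Finset.mem_filter.mp hp').2
      simp only [hμdef, heq, if_true]
      split_ifs with hs
      · rw [mul_one, abs_of_nonneg hs]
      · rw [mul_neg, mul_one, abs_of_neg (lt_of_not_ge hs)]
    have := h y' μ 1 hμs p
    rw [hT, mul_one] at this
    exact (le_abs_self _).trans this
  · intro h y' μ B hμ p
    have hT : T μ p = ∑ p' ∈ Finset.univ.filter (fun p' => blkP p' = y'), entry T p p' * μ p' := by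
      rw [apply_eq_sum_entry, ← Finset.sum_filter_add_sum_filter_not Finset.univ (fun p' => blkP p' = y')]
      have h0 : ∑ p' ∈ Finset.univ.filter (fun p' => ¬ blkP p' = y'), entry T p p' * μ p' = 0 :=
        Finset.sum_eq_zero fun p' hp' => by rw [hμ.off p' (Finset.mem_filter.mp hp').2, mul_zero]
      rw [h0, add_zero]
    rw [hT]
    calc |∑ p' ∈ Finset.univ.filter (fun p' => blkP p' = y'), entry T p p' * μ p'|
        ≤ ∑ p' ∈ Finset.univ.filter (fun p' => blkP p' = y'), |entry T p p' * μ p'| := Finset.abs_sum_le_sum_abs _ _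
      _ ≤ ∑ p' ∈ Finset.univ.filter (fun p' => blkP p' = y'), |entry T p p'| * B := by
          refine Finset.sum_le_sum fun p' hp' => ?_
          rw [abs_mul]
          exact mul_le_mul_of_nonneg_left (hμ.bound p' (Finset.mem_filter.mp hp').2) (abs_nonneg _)
      _ = (∑ p' ∈ Finset.univ.filter (fun p' => blkP p' = y'), |entry T p p'|) * B := by rw [Finset.sum_mul]
      _ ≤ K (blkP p) y' * B := mul_le_mul_of_nonneg_right (h p y') hμ.nonneg

/-- A block majorant bounds every single matrix entry (one term of the fibre row sum): `|T(δ_{p′})(p)| ≦ K(blkP p, blkP p′)` — the reading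
WITHOUT multiplicity factor. [cite: Balaban1984PropagatorsII, (2.51) p.232] -/
theorem entry_le_of_hasMajorant_blk (blkP : P → g.Site) {T : Module.End ℝ (P → ℝ)} {K : g.Site → g.Site → ℝ}
    (h : HasMajorant (g := toB6 g R H) blkP T K) (p p' : P) : |entry T p p'| ≤ K (blkP p) (blkP p') := by
  have hrow := (hasMajorant_blk_iff (R := R) (H := H) blkP T K).mp h p (blkP p')
  refine le_trans ?_ hrow
  exact Finset.single_le_sum (f := fun q => |entry T p q|) (fun _ _ => abs_nonneg _)
    (Finset.mem_filter.mpr ⟨Finset.mem_univ _, rfl⟩)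

/-- Conversely, ENTRYWISE bounds `|T(δ_{p′})(p)| ≦ K(blkP p, blkP p′)` with `K ≧ 0` give the block majorant `N·K` as soon as every fibre of
`blkP` has at most `N` points — the DISPLAYED multiplicity factor (for 𝔤-valued block functions in a real basis: `N = dim_ℝ 𝔤`; print's O(1)
is «dependent on d and L only» because the gauge group is fixed). [cite: Balaban1984PropagatorsII, (2.51) p.232; Balaban1985BackgroundPropagators, (3.8) p.392] -/
theorem hasMajorant_blk_of_entry_le (blkP : P → g.Site) {T : Module.End ℝ (P → ℝ)} {K : g.Site → g.Site → ℝ} (N : ℕ)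
    (hK : ∀ a b, 0 ≤ K a b) (hN : ∀ y' : g.Site, (Finset.univ.filter (fun p' : P => blkP p' = y')).card ≤ N)
    (h : ∀ p p' : P, |entry T p p'| ≤ K (blkP p) (blkP p')) :
    HasMajorant (g := toB6 g R H) blkP T (fun a b => (N : ℝ) * K a b) := by
  refine (hasMajorant_blk_iff (R := R) (H := H) blkP T _).mpr fun p y' => ?_
  calc ∑ p' ∈ Finset.univ.filter (fun p' => blkP p' = y'), |entry T p p'|
      ≤ ∑ p' ∈ Finset.univ.filter (fun p' => blkP p' = y'), K (blkP p) y' := by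
        refine Finset.sum_le_sum fun p' hp' => ?_
        have heq : blkP p' = y' := (Finset.mem_filter.mp hp').2
        rw [← heq]
        exact h p p'
    _ = ((Finset.univ.filter (fun p' => blkP p' = y')).card : ℝ) * K (blkP p) y' := by
        rw [Finset.sum_const, nsmul_eq_mul]
    _ ≤ (N : ℝ) * K (blkP p) y' := mul_le_mul_of_nonneg_right (Nat.cast_le.mpr (hN y')) (hK _ _)

omit [DecidableEq P] in
/-- The 𝔤-valued case `P = 𝔅 × ι′`, block map `Prod.fst` (a block function with values in a real space with basis indexed by `ι′`): entrywise
bounds `|T(δ_{(y′,i′)})(y,i)| ≦ K(y, y′)`, `K ≧ 0`, give the block majorant `|ι′|·K`. [cite: Balaban1985BackgroundPropagators, (3.8) p.392 + (3.48) p.398; Balaban1984PropagatorsII, (2.51) p.232] -/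
theorem hasMajorant_fst_of_entry_le {ι' : Type} [Fintype ι'] [DecidableEq ι'] {T : Module.End ℝ (g.Site × ι' → ℝ)}
    {K : g.Site → g.Site → ℝ} (hK : ∀ a b, 0 ≤ K a b)
    (h : ∀ p p' : g.Site × ι', |entry T p p'| ≤ K p.1 p'.1) :
    HasMajorant (g := toB6 g R H) (fun p : g.Site × ι' => p.1) T (fun a b => (Fintype.card ι' : ℝ) * K a b) := by
  classical
  refine hasMajorant_blk_of_entry_le (R := R) (H := H) (fun p : g.Site × ι' => p.1) (Fintype.card ι') hK (fun y' => ?_) h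
  have hsub : Finset.univ.filter (fun p' : g.Site × ι' => p'.1 = y') = (({y'} : Finset g.Site) ×ˢ (Finset.univ : Finset ι')) := by
    ext ⟨a, i⟩
    simp [eq_comm]
  rw [hsub, Finset.card_product, Finset.card_singleton, one_mul, Finset.card_univ]

omit [DecidableEq g.Site] [Fintype P] [DecidableEq P] in
/-- `−E` has the same block majorants as `E` (used for the Neumann series `Σ (−E)ⁿ` of (3.67) / [4] (2.66)). [cite: Balaban1984PropagatorsII, (2.51) p.232 + (2.66) p.234] -/
theorem hasMajorant_neg_blk (blkP : P → g.Site) {E : Module.End ℝ (P → ℝ)} {K : g.Site → g.Site → ℝ}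
    (h : HasMajorant (g := toB6 g R H) blkP E K) : HasMajorant (g := toB6 g R H) blkP (-E) K := by
  intro y' μ B hμ p
  rw [LinearMap.neg_apply, Pi.neg_apply, abs_neg]
  exact h y' μ B hμ p

/-- **Row sums from a block majorant** `θe^{−r·d(y,y′)}` and [4] (2.61) at the rate `r`, exponent `α′ ≦ 1`: `Σ_{p′∈P} |E(δ_{p′})(p)| ≦
θc₁(r, α′)` — the fibre row sums are summed over the blocks `y′ ∈ 𝔅` (every `p′` lies over exactly one block); NO multiplicity factor.
[cite: Balaban1984PropagatorsII, (2.61) p.234 + (2.51) p.232] -/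
theorem rowSum_le_of_majorant_blk (blkP : P → g.Site) (d : ℕ) (r α' θ : ℝ) (hθ : 0 ≤ θ) (hα' : α' ≤ 1) (hr : 0 ≤ r)
    (hdnn : ∀ a b : g.Site, 0 ≤ g.dist a b) (h261 : Ineq261 d (toB6 g R H) r α')
    {E : Module.End ℝ (P → ℝ)}
    (hE : HasMajorant (g := toB6 g R H) blkP E (fun a b => θ * Real.exp (-(r * g.dist a b)))) :
    ∀ p : P, ∑ p' : P, |entry E p p'| ≤ θ * B6.c1 d r α' := by
  intro p
  have h := (hasMajorant_blk_iff (R := R) (H := H) blkP _ _).mp hE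
  rw [← Finset.sum_fiberwise_of_maps_to (s := (Finset.univ : Finset P)) (t := (Finset.univ : Finset g.Site)) (g := blkP)
    (fun _ _ => Finset.mem_univ _) (fun p' => |entry E p p'|)]
  calc ∑ y' : g.Site, ∑ p' ∈ Finset.univ.filter (fun p' => blkP p' = y'), |entry E p p'|
      ≤ ∑ y' : g.Site, θ * Real.exp (-(α' * r * g.dist (blkP p) y')) := by
        refine Finset.sum_le_sum fun y' _ => (h p y').trans (mul_le_mul_of_nonneg_left ?_ hθ)
        refine Real.exp_le_exp.mpr ?_
        have := mul_nonneg (mul_nonneg (sub_nonneg.mpr hα') hr) (hdnn (blkP p) y')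
        nlinarith
    _ = θ * ∑ y' : g.Site, Real.exp (-(α' * r * g.dist (blkP p) y')) := by rw [Finset.mul_sum]
    _ ≤ θ * B6.c1 d r α' := mul_le_mul_of_nonneg_left (h261 (blkP p)) hθ

omit [DecidableEq g.Site] [DecidableEq P] [Fintype P] in
/-- **(3.67), second line, with its O(1) explicit, on the block carrier `(P, blkP)`**: «Using Theorem 3.2 and the above bound we obtain …
|C′(A)(Q′(U)G′²(U)Q′*(U))⁻¹(y, y′)| ≦ O(1)α₁(L^{j′}η)^{−d}e^{−(1/2)δ₀d(y,y′)}».  Hypotheses (block-majorant form, the pairing factor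
`(L^{j′}η)^{−d}` absorbed; `Pw(y) = (Lʲη)^{−4}`, any `Pw > 0`): `h366` = (3.66) for `C′(A)` with its O(1) =: `κ`; `h348` = (3.48) for `C⁻¹(U)`;
`hST` = the scale transfer `e^{−αδ₀d(y,y″)}Pw(y″) ≦ C·Pw(y)` of the p. 398 remark ([4] (2.60)); `h261` = (2.61) at the exponent `½ + α`; the
triangle inequality (2.54) and the symmetry of `d`.  Conclusion: `E = C′(A)·C⁻¹(U)` has the majorant `θe^{−(½−α)δ₀d(y,y′)}` with
`θ = κB₀Cc₁(½+α)·α₁` («O(1)α₁») — r06 gen 1's `B9Thm34Inv.ineq367_of_366_348`, route and constants verbatim, the block map `id` replaced by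
`blkP` ([4] (2.52): «this property is preserved under the composition of operators possessing it» is carrier-generic, `hasMajorant_mul`).
LOCATED (G-B9-21): the printed rate `½δ₀` is obtained as `(½−α)δ₀`, `0 < α < ½` arbitrary.
[cite: Balaban1985BackgroundPropagators, (3.66)–(3.67) p.403 + p.398 remark; Balaban1984PropagatorsII, Lemma 2.1 p.234 + (2.52)–(2.55) p.232] -/
theorem ineq367_of_366_348_blk [Fintype P] (blkP : P → g.Site) (d : ℕ) (δ₀ α κ B₀ C α₁ : ℝ) (Pw : g.Site → ℝ)
    (hκ : 0 ≤ κ) (hα₁ : 0 ≤ α₁) (hB₀ : 0 ≤ B₀) (hC : 0 ≤ C) (hP : ∀ y, 0 < Pw y) (hα : α ≤ 1 / 2) (hδ₀ : 0 ≤ δ₀)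
    (htri : Triangle254 (toB6 g R H)) (hsymm : ∀ a b : g.Site, g.dist a b = g.dist b a)
    (hST : ScaleTransfer g δ₀ α C Pw)
    (h261 : Ineq261 d (toB6 g R H) δ₀ (1 / 2 + α))
    {Cp Linv : Module.End ℝ (P → ℝ)}
    (h366 : HasMajorant (g := toB6 g R H) blkP Cp (fun a b => κ * α₁ * (Pw a)⁻¹ * Real.exp (-(δ₀ / 2 * g.dist a b))))
    (h348 : HasMajorant (g := toB6 g R H) blkP Linv (fun a b => B₀ * Pw a * Real.exp (-(δ₀ * g.dist a b)))) :
    HasMajorant (g := toB6 g R H) blkP (Cp * Linv)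
      (fun a b => κ * α₁ * B₀ * C * B6.c1 d δ₀ (1 / 2 + α) * Real.exp (-((1 / 2 - α) * δ₀ * g.dist a b))) := by
  have hK₂ : ∀ a b : g.Site, 0 ≤ B₀ * Pw a * Real.exp (-(δ₀ * g.dist a b)) := fun a b =>
    mul_nonneg (mul_nonneg hB₀ (hP a).le) (Real.exp_nonneg _)
  refine hasMajorant_mono (g := toB6 g R H) _ (hasMajorant_mul (g := toB6 g R H) _ h366 h348 hK₂) fun a b => ?_
  have hcoef : 0 ≤ (1 / 2 - α) * δ₀ := mul_nonneg (by linarith) hδ₀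
  have hterm : ∀ y'' : g.Site,
      κ * α₁ * (Pw a)⁻¹ * Real.exp (-(δ₀ / 2 * g.dist a y'')) * (B₀ * Pw y'' * Real.exp (-(δ₀ * g.dist y'' b))) ≤
        κ * α₁ * B₀ * C * Real.exp (-((1 / 2 - α) * δ₀ * g.dist a b)) *
          Real.exp (-((1 / 2 + α) * δ₀ * g.dist b y'')) := by
    intro y''
    -- (i) the scale transfer (L^jη)⁴ e^{−αδ₀d(y,y″)} (L^{j″}η)^{−4} ≦ C
    have hst : (Pw a)⁻¹ * (Real.exp (-(α * δ₀ * g.dist a y'')) * Pw y'') ≤ C := by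
      have h1 := hST a y''
      calc (Pw a)⁻¹ * (Real.exp (-(α * δ₀ * g.dist a y'')) * Pw y'') ≤ (Pw a)⁻¹ * (C * Pw a) :=
            mul_le_mul_of_nonneg_left h1 (inv_nonneg.mpr (hP a).le)
        _ = C := by rw [mul_comm C, ← mul_assoc, inv_mul_cancel₀ (hP a).ne', one_mul]
    -- (ii) the splitting of the exponential
    have hsplit : Real.exp (-(δ₀ / 2 * g.dist a y'')) =
        Real.exp (-(α * δ₀ * g.dist a y'')) * Real.exp (-((1 / 2 - α) * δ₀ * g.dist a y'')) := by
      rw [← Real.exp_add]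
      congr 1
      ring
    -- (iii) the triangle inequality (2.54) and the symmetry of d
    have htri' : Real.exp (-((1 / 2 - α) * δ₀ * g.dist a y'')) * Real.exp (-(δ₀ * g.dist y'' b)) ≤
        Real.exp (-((1 / 2 - α) * δ₀ * g.dist a b)) * Real.exp (-((1 / 2 + α) * δ₀ * g.dist b y'')) := by
      rw [← Real.exp_add, ← Real.exp_add]
      refine Real.exp_le_exp.mpr ?_
      have h0 : g.dist a b ≤ g.dist a y'' + g.dist y'' b := htri a y'' b
      have h1 := mul_le_mul_of_nonneg_left h0 hcoef
      rw [hsymm b y'']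
      linarith
    have hE : 0 ≤ Real.exp (-((1 / 2 - α) * δ₀ * g.dist a y'')) * Real.exp (-(δ₀ * g.dist y'' b)) :=
      mul_nonneg (Real.exp_nonneg _) (Real.exp_nonneg _)
    calc κ * α₁ * (Pw a)⁻¹ * Real.exp (-(δ₀ / 2 * g.dist a y'')) * (B₀ * Pw y'' * Real.exp (-(δ₀ * g.dist y'' b)))
        = κ * α₁ * B₀ * ((Pw a)⁻¹ * (Real.exp (-(α * δ₀ * g.dist a y'')) * Pw y'')) *
            (Real.exp (-((1 / 2 - α) * δ₀ * g.dist a y'')) * Real.exp (-(δ₀ * g.dist y'' b))) := by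
          rw [hsplit]; ring
      _ ≤ κ * α₁ * B₀ * C *
            (Real.exp (-((1 / 2 - α) * δ₀ * g.dist a b)) * Real.exp (-((1 / 2 + α) * δ₀ * g.dist b y''))) := by
          have hkab : 0 ≤ κ * α₁ * B₀ := mul_nonneg (mul_nonneg hκ hα₁) hB₀
          exact mul_le_mul (mul_le_mul_of_nonneg_left hst hkab) htri' hE (mul_nonneg hkab hC)
      _ = _ := by ring
  have hpref : 0 ≤ κ * α₁ * B₀ * C * Real.exp (-((1 / 2 - α) * δ₀ * g.dist a b)) :=
    mul_nonneg (mul_nonneg (mul_nonneg (mul_nonneg hκ hα₁) hB₀) hC) (Real.exp_nonneg _)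
  calc ∑ y'' : g.Site, κ * α₁ * (Pw a)⁻¹ * Real.exp (-(δ₀ / 2 * g.dist a y'')) *
          (B₀ * Pw y'' * Real.exp (-(δ₀ * g.dist y'' b)))
      ≤ ∑ y'' : g.Site, κ * α₁ * B₀ * C * Real.exp (-((1 / 2 - α) * δ₀ * g.dist a b)) *
          Real.exp (-((1 / 2 + α) * δ₀ * g.dist b y'')) := Finset.sum_le_sum fun y'' _ => hterm y''
    _ = κ * α₁ * B₀ * C * Real.exp (-((1 / 2 - α) * δ₀ * g.dist a b)) *
          ∑ y'' : g.Site, Real.exp (-((1 / 2 + α) * δ₀ * g.dist b y'')) := by rw [Finset.mul_sum]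
    _ ≤ κ * α₁ * B₀ * C * Real.exp (-((1 / 2 - α) * δ₀ * g.dist a b)) * B6.c1 d δ₀ (1 / 2 + α) :=
        mul_le_mul_of_nonneg_left (h261 b) hpref
    _ = κ * α₁ * B₀ * C * B6.c1 d δ₀ (1 / 2 + α) * Real.exp (-((1 / 2 - α) * δ₀ * g.dist a b)) := by ring

/-- «thus the operators in the equality are invertible» on the block carrier: with `E = C′(A)C⁻¹(U)` of block majorant `θe^{−r·d}` (`r ≧ 0`),
[4] (2.61) at `(r, α′)`, `α′ ≦ 1`, the smallness `θc₁(r, α′) < 1`, (3.65) `L′ = L + C′(A)` and `C⁻¹(U)` a two-sided inverse of `L`, the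
operator `L′ = Q′(U′U)G′²(U′U)Q′*(U′U)` is invertible — the row sums of the matrix of `E` over ALL of `P` are `< 1` (`rowSum_le_of_majorant_blk`),
maximum principle on the finite set `P` (`B9Thm34Inv.isUnit_one_add_of_rowSum`, carrier-generic), (3.67) first line (`factor_367`).
[cite: Balaban1985BackgroundPropagators, (3.65)–(3.67) p.403] -/
theorem isUnit_ext_blk (blkP : P → g.Site) (d : ℕ) (r α' θ : ℝ) (hθ : 0 ≤ θ) (hα' : α' ≤ 1) (hr : 0 ≤ r)
    (hdnn : ∀ a b : g.Site, 0 ≤ g.dist a b) (h261 : Ineq261 d (toB6 g R H) r α')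
    (hsmall : θ * B6.c1 d r α' < 1)
    {L L' Linv Cp : Module.End ℝ (P → ℝ)} (hL : L * Linv = 1) (hLinv : Linv * L = 1) (h365 : L' = L + Cp)
    (h367 : HasMajorant (g := toB6 g R H) blkP (Cp * Linv) (fun a b => θ * Real.exp (-(r * g.dist a b)))) :
    IsUnit L' := by
  have h1 : IsUnit (1 + Cp * Linv) :=
    isUnit_one_add_of_rowSum _ _ hsmall (rowSum_le_of_majorant_blk (R := R) (H := H) blkP d r α' θ hθ hα' hr hdnn h261 h367)
  have h2 : IsUnit L := ⟨⟨L, Linv, hL, hLinv⟩, rfl⟩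
  rw [factor_367 hLinv h365]
  exact h1.mul h2

omit [DecidableEq g.Site] in
/-- **«The inverse satisfies Theorem 3.2», with the constants named, on the block carrier**: if the inverse `T` of `L′` satisfies the fixed-point
equation `T = C⁻¹(U) − T·E` of the Neumann series, `C⁻¹(U)` has the (3.48)-majorant `B₀Pw(y)e^{−r·d}` (rate weakened to `r`) and `E` the
(3.67)-majorant `θe^{−r·d}`, [4] Lemma 2.1 holds at `(r, α′)` and `θc₁(r, α′) < 1` («convergent for α₁ sufficiently small»), then `T` has the
majorant `B₀c₁(r,α′)(1 − θc₁(r,α′))⁻¹Pw(y)e^{−(1−α′)r·d(y,y′)}` — pv08's `B6RandomWalk.majorant_of_fixedPoint_266` ([4] (2.66)), which is stated for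
an arbitrary block map. [cite: Balaban1985BackgroundPropagators, (3.67) p.403; Balaban1984PropagatorsII, (2.66) p.234] -/
theorem inv_majorant_of_367_blk (blkP : P → g.Site) (d : ℕ) (r α' θ B₀ : ℝ) (Pw : g.Site → ℝ)
    (hB₀ : 0 ≤ B₀) (hP : ∀ y, 0 ≤ Pw y) (hθ : 0 ≤ θ) (hr : 0 ≤ r) (hα' : α' ≤ 1)
    (htri : Triangle254 (toB6 g R H)) (hrefl : ∀ y : g.Site, g.dist y y = 0)
    (hdnn : ∀ a b : g.Site, 0 ≤ g.dist a b) (h261 : Ineq261 d (toB6 g R H) r α')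
    (hsmall : θ * B6.c1 d r α' < 1)
    {T Linv E : Module.End ℝ (P → ℝ)}
    (h348 : HasMajorant (g := toB6 g R H) blkP Linv (fun a b => B₀ * Pw a * Real.exp (-(r * g.dist a b))))
    (h367 : HasMajorant (g := toB6 g R H) blkP E (fun a b => θ * Real.exp (-(r * g.dist a b))))
    (hfix : T = Linv - T * E) :
    HasMajorant (g := toB6 g R H) blkP T
      (fun a b => B₀ * B6.c1 d r α' * (1 - θ * B6.c1 d r α')⁻¹ * Pw a * Real.exp (-((1 - α') * r * g.dist a b))) := by
  have hαδ : 0 ≤ (1 - α') * r := mul_nonneg (sub_nonneg.mpr hα') hr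
  have h263 := B9Thm34Ext.h263_of_h261 g R H d r α' htri hr hα' h261
  have hneg := hasMajorant_neg_blk (R := R) (H := H) blkP h367
  have hfix' : T = Linv + T * (-E) :=
    hfix.trans ((sub_eq_add_neg Linv (T * E)).trans (congrArg (fun Z => Linv + Z) (mul_neg T E).symm))
  exact majorant_of_fixedPoint_266 (g := toB6 g R H) blkP d r α' θ B₀ Pw hB₀ hP hθ hαδ htri hrefl hdnn h261 h263 hsmall h348 hneg hfix'

/-- Real-power bookkeeping: `((Lʲη)^{−4})⁻¹ = (Lʲη)^4` as a real power. [folklore] -/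
private theorem rpow_neg_four_inv {x : ℝ} (hx : 0 < x) : (x ^ (-(4 : ℝ)))⁻¹ = x ^ (4 : ℝ) := by
  rw [Real.rpow_neg hx.le, inv_inv]

/-- **B9 p. 403, «thus the operators in the equality are invertible and an inverse of the left-hand side can be expressed by a Neumann
series convergent for α₁ sufficiently small. … The inverse satisfies Theorem 3.2», ON THE BLOCK CARRIER `(P, blkP)`, threshold and new
constants EXPLICIT.**  Data: `L = Q′(U)G′²(U)Q′*(U)` acting on the functions on `P` with two-sided inverse `C⁻¹(U)` (`Linv`, `hL`),
`L′ = Q′(U′U)G′²(U′U)Q′*(U′U) = L + C′(A)` ((3.65), `h365`).  Hypotheses of the printed shape in block-majorant form ([4] (2.51) for the block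
map `blkP`; the factor `(L^{j′}η)^{−d}` of the printed kernels is the pairing weight, absorbed as in `B9Thm34Inv.ker_le_iff`): `h348` =
Theorem 3.2 (3.48) for `C⁻¹(U)`, majorant `B₀(Lʲη)^{−4}e^{−δ₀d}`; `h366` = (3.66) for `C′(A)`, majorant `κα₁(Lʲη)⁴e^{−½δ₀d}`; [4] Lemma 2.1:
the scale transfer of the p. 398 remark at exponent `α` for the weight `(Lʲη)^{−4}` with constant `C` and (2.61) at `(δ₀, ½+α)`,
`((½−α)δ₀, α′)`; the distance axioms; and the EXPLICIT smallness `α₁ ≦ a₁ := (2κB₀Cc₁(δ₀, ½+α)·c₁((½−α)δ₀, α′))⁻¹`.  Conclusion: `L′` has a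
two-sided inverse `T` with the block majorant `B₁′(Lʲη)^{−4}e^{−δ₁′d(y,y′)}`, **`B₁′ = 2B₀c₁((½−α)δ₀, α′)`**, **`δ₁′ = (1−α′)(½−α)δ₀`** — (3.48)
at `U′U`, the constants of r06 gen 1's scalar `inverse_satisfies_thm32` LITERALLY (no multiplicity factor).
[cite: Balaban1985BackgroundPropagators, Thm 3.2 (3.48) p.398 + (3.65)–(3.67) p.403 + Thm 3.4 p.400 + p.398 remark; Balaban1984PropagatorsII, Lemma 2.1 p.234 + (2.66) p.234] -/
theorem inverse_satisfies_thm32_blk (blkP : P → g.Site) (d : ℕ) (δ₀ α α' κ B₀ C α₁ : ℝ)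
    (hδ₀ : 0 < δ₀) (hα0 : 0 < α) (hα : α < 1 / 2) (hα' : α' < 1)
    (hκ : 0 < κ) (hB₀ : 0 < B₀) (hC : 0 < C) (hα₁ : 0 ≤ α₁)
    (hc₁ : 0 < B6.c1 d δ₀ (1 / 2 + α)) (hc₁' : 0 < B6.c1 d ((1 / 2 - α) * δ₀) α')
    (htri : Triangle254 (toB6 g R H)) (hsymm : ∀ a b : g.Site, g.dist a b = g.dist b a)
    (hrefl : ∀ y : g.Site, g.dist y y = 0) (hdnn : ∀ a b : g.Site, 0 ≤ g.dist a b)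
    (hlen : ∀ y : g.Site, 0 < g.len y)
    (hST : ScaleTransfer g δ₀ α C (fun y => g.len y ^ (-(4 : ℝ))))
    (h261 : Ineq261 d (toB6 g R H) δ₀ (1 / 2 + α))
    (h261' : Ineq261 d (toB6 g R H) ((1 / 2 - α) * δ₀) α')
    (ha₁ : α₁ ≤ (2 * (κ * B₀ * C * B6.c1 d δ₀ (1 / 2 + α)) * B6.c1 d ((1 / 2 - α) * δ₀) α')⁻¹)
    {L L' Linv Cp : Module.End ℝ (P → ℝ)}
    (hL : L * Linv = 1)
    (h348 : HasMajorant (g := toB6 g R H) blkP Linv (fun a b => B₀ * g.len a ^ (-(4 : ℝ)) * Real.exp (-(δ₀ * g.dist a b))))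
    (h365 : L' = L + Cp)
    (h366 : HasMajorant (g := toB6 g R H) blkP Cp (fun a b => κ * α₁ * g.len a ^ (4 : ℝ) * Real.exp (-(δ₀ / 2 * g.dist a b)))) :
    ∃ T : Module.End ℝ (P → ℝ), T * L' = 1 ∧ L' * T = 1 ∧
      HasMajorant (g := toB6 g R H) blkP T (fun a b =>
        2 * B₀ * B6.c1 d ((1 / 2 - α) * δ₀) α' * g.len a ^ (-(4 : ℝ)) * Real.exp (-((1 - α') * ((1 / 2 - α) * δ₀) * g.dist a b))) := by
  -- abbreviations
  set Pw : g.Site → ℝ := fun y => g.len y ^ (-(4 : ℝ)) with hPdef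
  set r : ℝ := (1 / 2 - α) * δ₀ with hrdef
  set c : ℝ := B6.c1 d δ₀ (1 / 2 + α) with hcdef
  set c' : ℝ := B6.c1 d r α' with hc'def
  set θ : ℝ := κ * α₁ * B₀ * C * c with hθdef
  have hP : ∀ y, 0 < Pw y := fun y => Real.rpow_pos_of_pos (hlen y) _
  have hPinv : ∀ y, (Pw y)⁻¹ = g.len y ^ (4 : ℝ) := fun y => rpow_neg_four_inv (hlen y)
  have hr : 0 ≤ r := mul_nonneg (by linarith) hδ₀.le
  have hrδ : r ≤ δ₀ := by
    have : r = δ₀ - (1 / 2 + α) * δ₀ := by rw [hrdef]; ring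
    nlinarith
  have hθ : 0 ≤ θ := by positivity
  -- the smallness θ c' ≤ 1/2 from α₁ ≤ a₁
  have hprod : 0 < 2 * (κ * B₀ * C * c) * c' := by positivity
  have hθc : θ * c' ≤ 1 / 2 := by
    have h1 : α₁ * (2 * (κ * B₀ * C * c) * c') ≤ 1 := by
      have := mul_le_mul_of_nonneg_right ha₁ hprod.le
      rwa [inv_mul_cancel₀ hprod.ne'] at this
    have : θ * c' = α₁ * (2 * (κ * B₀ * C * c) * c') / 2 := by rw [hθdef]; ring
    rw [this]
    linarith
  have hsmall : θ * c' < 1 := by linarith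
  -- (3.66) with the weight written as `(Pw y)⁻¹`
  have h366e : HasMajorant (g := toB6 g R H) blkP Cp (fun a b => κ * α₁ * (Pw a)⁻¹ * Real.exp (-(δ₀ / 2 * g.dist a b))) :=
    hasMajorant_mono (g := toB6 g R H) _ h366 fun a b => by rw [hPinv a]
  -- (3.67): the majorant of E = C′(A)·C⁻¹(U)
  have h367 : HasMajorant (g := toB6 g R H) blkP (Cp * Linv) (fun a b => θ * Real.exp (-(r * g.dist a b))) := by
    have h := ineq367_of_366_348_blk (R := R) (H := H) blkP d δ₀ α κ B₀ C α₁ Pw hκ.le hα₁ hB₀.le hC.le hP hα.le hδ₀.le htri hsymm hST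
      h261 h366e h348
    refine hasMajorant_mono (g := toB6 g R H) _ h fun a b => le_of_eq ?_
    simp only [hθdef, hcdef, hrdef]
  -- invertibility of L′ and the fixed-point equation of its inverse
  have hLinv : Linv * L = 1 := mul_eq_one_symm hL
  have hunit : IsUnit L' := isUnit_ext_blk (R := R) (H := H) blkP d r α' θ hθ hα'.le hr hdnn h261' hsmall hL hLinv h365 h367
  obtain ⟨u, hu⟩ := hunit
  refine ⟨↑u⁻¹, by rw [← hu]; exact u.inv_mul, by rw [← hu]; exact u.mul_inv, ?_⟩
  have hT : (↑u⁻¹ : Module.End ℝ (P → ℝ)) * L' = 1 := by rw [← hu]; exact u.inv_mul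
  have hfix := fixedPoint_of_inverse hL h365 hT
  -- (3.48) for C⁻¹(U) with the rate weakened to r
  have h348r : HasMajorant (g := toB6 g R H) blkP Linv (fun a b => B₀ * Pw a * Real.exp (-(r * g.dist a b))) := by
    refine hasMajorant_mono (g := toB6 g R H) _ h348 fun a b => ?_
    refine mul_le_mul_of_nonneg_left (Real.exp_le_exp.mpr ?_) (mul_nonneg hB₀.le (hP a).le)
    have := mul_le_mul_of_nonneg_right hrδ (hdnn a b)
    linarith
  -- the Neumann series bound, then (1 − θc')⁻¹ ≦ 2
  have hmaj := inv_majorant_of_367_blk (R := R) (H := H) blkP d r α' θ B₀ Pw hB₀.le (fun y => (hP y).le) hθ hr hα'.le htri hrefl hdnn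
    h261' hsmall h348r h367 hfix
  refine hasMajorant_mono (g := toB6 g R H) _ hmaj fun a b => ?_
  have hinv : (1 - θ * c')⁻¹ ≤ 2 := by
    rw [inv_le_comm₀ (by linarith) (by norm_num : (0 : ℝ) < 2)]
    linarith
  have hconst : B₀ * c' * (1 - θ * c')⁻¹ ≤ 2 * B₀ * c' := by
    calc B₀ * c' * (1 - θ * c')⁻¹ ≤ B₀ * c' * 2 := mul_le_mul_of_nonneg_left hinv (mul_nonneg hB₀.le hc₁'.le)
      _ = 2 * B₀ * c' := by ring
  have hrest : 0 ≤ Pw a * Real.exp (-((1 - α') * r * g.dist a b)) := mul_nonneg (hP a).le (Real.exp_nonneg _)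
  calc B₀ * c' * (1 - θ * c')⁻¹ * Pw a * Real.exp (-((1 - α') * r * g.dist a b))
      = B₀ * c' * (1 - θ * c')⁻¹ * (Pw a * Real.exp (-((1 - α') * r * g.dist a b))) := by ring
    _ ≤ 2 * B₀ * c' * (Pw a * Real.exp (-((1 - α') * r * g.dist a b))) := mul_le_mul_of_nonneg_right hconst hrest
    _ = _ := by simp only [hPdef, hc'def, hrdef]; ring

end Device

/-! ## §2  (3.66) for the two-space letters with the block functions on `(P, blkP)` -/

section Hetero

variable {g : B9.Geometry} [Fintype g.Site] [DecidableEq g.Site] {R : ℝ} {H : Prop} {X P : Type}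

omit [DecidableEq g.Site] in
/-- A site endomorphism with majorant `K ≧ 0` embeds as `(· 0; 0 0)` on the functions on `X ⊕ P` with the same majorant for the block map
`Sum.elim blk blkP`. [cite: Balaban1984PropagatorsII, (2.51) p.232] -/
theorem hasMajorant_emb_site_blk (blk : X → g.Site) (blkP : P → g.Site) {T : Module.End ℝ (X → ℝ)} {K : g.Site → g.Site → ℝ}
    (hK : ∀ a b, 0 ≤ K a b) (h : HasMajorant (g := toB6 g R H) blk T K) :
    HasMajorant (g := toB6 g R H) (Sum.elim blk blkP) (B6RandomWalkHom.emb T (0 : (X → ℝ) →ₗ[ℝ] (P → ℝ))) K :=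
  hasMajorant_emb (g := toB6 g R H) h (hasMajorantHom_zero (g := toB6 g R H) _ _) (fun _ _ => le_rfl) hK

omit [DecidableEq g.Site] in
/-- A product of two site endomorphisms embeds as the product of the embeddings (`emb_mul`). [cite: Balaban1984PropagatorsII, (2.52) p.232] -/
theorem hasMajorant_emb_site_mul_blk (blk : X → g.Site) (blkP : P → g.Site) {V T : Module.End ℝ (X → ℝ)} {K : g.Site → g.Site → ℝ}
    (hK : ∀ a b, 0 ≤ K a b) (h : HasMajorant (g := toB6 g R H) blk (V * T) K) :
    HasMajorant (g := toB6 g R H) (Sum.elim blk blkP)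
      (B6RandomWalkHom.emb V (0 : (X → ℝ) →ₗ[ℝ] (P → ℝ)) * B6RandomWalkHom.emb T (0 : (X → ℝ) →ₗ[ℝ] (P → ℝ))) K := by
  rw [B6RandomWalkHom.emb_mul, LinearMap.zero_comp]
  exact hasMajorant_emb_site_blk (R := R) (H := H) blk blkP hK h

omit [DecidableEq g.Site] in
/-- A sites-to-blocks letter (`Q′`, `F′₂`) with two-space majorant `K ≧ 0` embeds as `(0 0; · 0)` with the same majorant.
[cite: Balaban1984PropagatorsII, (2.51) p.232] -/
theorem hasMajorant_emb_toBlocks_blk (blk : X → g.Site) (blkP : P → g.Site) {S : (X → ℝ) →ₗ[ℝ] (P → ℝ)} {K : g.Site → g.Site → ℝ}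
    (hK : ∀ a b, 0 ≤ K a b) (h : HasMajorantHom (g := toB6 g R H) blk blkP S K) :
    HasMajorant (g := toB6 g R H) (Sum.elim blk blkP) (B6RandomWalkHom.emb (0 : Module.End ℝ (X → ℝ)) S) K :=
  hasMajorant_emb (g := toB6 g R H) (hasMajorant_zero (g := toB6 g R H) blk) h hK (fun _ _ => le_rfl)

omit [DecidableEq g.Site] in
/-- A blocks-to-sites letter (`Q′*`, `F′₂*`) with two-space majorant `K ≧ 0` embeds as `(0 ·; 0 0)` with the same majorant.
[cite: Balaban1984PropagatorsII, (2.51) p.232] -/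
theorem hasMajorant_embL_toSites_blk (blk : X → g.Site) (blkP : P → g.Site) {T : (P → ℝ) →ₗ[ℝ] (X → ℝ)} {K : g.Site → g.Site → ℝ}
    (hK : ∀ a b, 0 ≤ K a b) (h : HasMajorantHom (g := toB6 g R H) blkP blk T K) :
    HasMajorant (g := toB6 g R H) (Sum.elim blk blkP) (B6RandomWalkHom.embL (0 : Module.End ℝ (X → ℝ)) T) K :=
  hasMajorant_embL_right (g := toB6 g R H) h hK

/-- **(3.66) FOR THE TWO-SPACE LETTERS INTO THE BLOCK CARRIER `(P, blkP)`** — «Using the results obtained for operators building it, and Lemma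
2.1 [4], in the same way as in the bounds (2.68) in [4], we get |C′(A; y, y′)| ≦ O(1)α₁(Lʲη)⁴(L^{j′}η)^{−d}e^{−ρ d(y,y′)}»: with `Q′, F′₂ :
(X → ℝ) →ₗ (P → ℝ)` and `Q′*, F′₂* : (P → ℝ) →ₗ (X → ℝ)` carrying the block-diagonal two-space majorants `κ_Q·𝟙[y = y′]`, `c_Fα₁·𝟙[y = y′]`
((3.19), (3.59)), Theorem 3.1 (3.42)₁ for `G′(U)` (`B₀`) and `G′(U′U)` (`B₁`), (3.63) for `V′G′(U)`, `V′G′(U′U)` (`c_V`) at a common rate `δ`, the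
scale transfer of `(Lʲη)²` at `α` with constant `C` and (2.61) at `β`, `ρ + (α+β)δ₀ ≦ δ`: the operator `C′(A)` on the functions on `P`
(`cPrimeHom Q′ F′₂ Q′* F′₂* G′ E V′`, the printed six-term sum) has the majorant `κ₃₆₆α₁(Lʲη)⁴e^{−ρ d(y,y′)}` FOR THE BLOCK MAP `blkP`,
`κ₃₆₆ = kappa366 κ_Q c_F c_V B₀ B₁ C c₁(β) α₁`.  PROOF = gen 6's `hasMajorant_cPrimeHom` with `id ↦ blkP`: embed the seven letters in the
functions on `X ⊕ P` (block map `Sum.elim blk blkP`), apply the carrier-generic `hasMajorant_cPrime`, read the `P`-corner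
(`cornerR_cPrime_emb`, `hasMajorant_cornerR`). [cite: Balaban1985BackgroundPropagators, (3.65)–(3.66) p.403 + (3.19) p.393 + (3.59) p.402 + (3.63) p.402 + Thm 3.1 (3.42) p.397; Balaban1984PropagatorsII, Lemma 2.1 p.234 + (2.51)–(2.55) p.232 + (2.68) p.235] -/
theorem hasMajorant_cPrimeHom_blk (blk : X → g.Site) (blkP : P → g.Site) (d : ℕ) (δ₀ δ α β ρ C κQ cF cV B₀ B₁ α₁ : ℝ)
    (hκQ : 0 ≤ κQ) (hcF : 0 ≤ cF) (hcV : 0 ≤ cV) (hB₀ : 0 ≤ B₀) (hB₁ : 0 ≤ B₁) (hα₁ : 0 ≤ α₁) (hC : 0 ≤ C)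
    (hρ : 0 ≤ ρ) (hαδ : 0 ≤ α * δ₀) (hβδ : 0 ≤ β * δ₀) (hr : ρ + (α + β) * δ₀ ≤ δ)
    (hdnn : ∀ a b : g.Site, 0 ≤ g.dist a b) (htri : Triangle254 (toB6 g R H))
    (hST : ScaleTransfer g δ₀ α C (fun y => g.len y ^ 2)) (h261 : Ineq261 d (toB6 g R H) δ₀ β)
    {Q F₂ : (X → ℝ) →ₗ[ℝ] (P → ℝ)} {Qs F₂s : (P → ℝ) →ₗ[ℝ] (X → ℝ)} {G E V : Module.End ℝ (X → ℝ)}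
    (hQ : HasMajorantHom (g := toB6 g R H) blk blkP Q (fun a b : g.Site => κQ * (if a = b then (1 : ℝ) else 0)))
    (hQs : HasMajorantHom (g := toB6 g R H) blkP blk Qs (fun a b : g.Site => κQ * (if a = b then (1 : ℝ) else 0)))
    (hF : HasMajorantHom (g := toB6 g R H) blk blkP F₂ (fun a b : g.Site => cF * α₁ * (if a = b then (1 : ℝ) else 0)))
    (hFs : HasMajorantHom (g := toB6 g R H) blkP blk F₂s (fun a b : g.Site => cF * α₁ * (if a = b then (1 : ℝ) else 0)))
    (hG : HasMajorant (g := toB6 g R H) blk G (fun a b => B₀ * g.len a ^ 2 * Real.exp (-(δ * g.dist a b))))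
    (hE : HasMajorant (g := toB6 g R H) blk E (fun a b => B₁ * g.len a ^ 2 * Real.exp (-(δ * g.dist a b))))
    (hVG : HasMajorant (g := toB6 g R H) blk (V * G) (fun a b => cV * α₁ * B₀ * Real.exp (-(δ * g.dist a b))))
    (hVE : HasMajorant (g := toB6 g R H) blk (V * E) (fun a b => cV * α₁ * B₁ * Real.exp (-(δ * g.dist a b)))) :
    HasMajorant (g := toB6 g R H) blkP (cPrimeHom Q F₂ Qs F₂s G E V)
      (fun a b => kappa366 κQ cF cV B₀ B₁ C (B6.c1 d δ₀ β) α₁ * α₁ * g.len a ^ 4 * Real.exp (-(ρ * g.dist a b))) := by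
  have hcFα : 0 ≤ cF * α₁ := mul_nonneg hcF hα₁
  -- the block-diagonal majorants in the `if … then κ else 0` form
  have hind : ∀ κ : ℝ, (fun a b : g.Site => κ * (if a = b then (1 : ℝ) else 0)) = fun a b : g.Site => if a = b then κ else 0 :=
    fun κ => by
      funext a b
      split_ifs <;> simp
  rw [hind] at hQ hQs hF hFs
  have hKQ : ∀ a b : g.Site, 0 ≤ (fun a b : g.Site => if a = b then κQ else 0) a b := fun a b => by
    show 0 ≤ (if a = b then κQ else 0)
    split_ifs
    · exact hκQ
    · exact le_rfl
  have hKF : ∀ a b : g.Site, 0 ≤ (fun a b : g.Site => if a = b then cF * α₁ else 0) a b := fun a b => by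
    show 0 ≤ (if a = b then cF * α₁ else 0)
    split_ifs
    · exact hcFα
    · exact le_rfl
  have hKG : ∀ a b : g.Site, 0 ≤ B₀ * g.len a ^ 2 * Real.exp (-(δ * g.dist a b)) := fun a b => by positivity
  have hKE : ∀ a b : g.Site, 0 ≤ B₁ * g.len a ^ 2 * Real.exp (-(δ * g.dist a b)) := fun a b => by positivity
  have hKVG : ∀ a b : g.Site, 0 ≤ cV * α₁ * B₀ * Real.exp (-(δ * g.dist a b)) := fun a b => by positivity
  have hKVE : ∀ a b : g.Site, 0 ≤ cV * α₁ * B₁ * Real.exp (-(δ * g.dist a b)) := fun a b => by positivity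
  rw [← cornerR_cPrime_emb]
  exact hasMajorant_cornerR (g := toB6 g R H) blk blkP
    (hasMajorant_cPrime (R := R) (H := H) (Sum.elim blk blkP) d δ₀ δ α β ρ C κQ cF cV B₀ B₁ α₁ hκQ hcF hcV hB₀ hB₁ hα₁ hC hρ hαδ hβδ
      hr hdnn htri hST h261
      (hasMajorant_emb_toBlocks_blk (R := R) (H := H) blk blkP hKQ hQ) (hasMajorant_embL_toSites_blk (R := R) (H := H) blk blkP hKQ hQs)
      (hasMajorant_emb_toBlocks_blk (R := R) (H := H) blk blkP hKF hF) (hasMajorant_embL_toSites_blk (R := R) (H := H) blk blkP hKF hFs)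
      (hasMajorant_emb_site_blk (R := R) (H := H) blk blkP hKG hG) (hasMajorant_emb_site_blk (R := R) (H := H) blk blkP hKE hE)
      (hasMajorant_emb_site_mul_blk (R := R) (H := H) blk blkP hKVG hVG)
      (hasMajorant_emb_site_mul_blk (R := R) (H := H) blk blkP hKVE hVE))

end Hetero

/-! ## §3  (3.66) and «The inverse satisfies Theorem 3.2» for the CONCRETE `V′(A)` of (3.60), block functions on `(P, blkP)` -/

section Concrete

variable {𝔸 : Type*} [NormedRing 𝔸] [NormedAlgebra ℂ 𝔸] [CompleteSpace 𝔸] {ι : Type} [Fintype ι] [DecidableEq ι]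
variable (b : Module.Basis ι ℝ 𝔸) {S : Type} [Fintype S] [DecidableEq S] {κ : Type} [Fintype κ]
variable (T : κ → Equiv.Perm S) (U : κ → S → 𝔸ˣ)
variable {g : B9.Geometry} [Fintype g.Site] [DecidableEq g.Site] {Rr : ℝ} {H : Prop}
variable {P : Type} [Fintype P] [DecidableEq P]

omit [Fintype g.Site] [DecidableEq g.Site] in
/-- Rate weakening `e^{−r d} ≦ e^{−ρ d}` for `ρ ≦ r`, `d ≧ 0`. [cite: Balaban1984PropagatorsII, (2.51) p.232] -/
private theorem exp_rate_le {ρ r dd : ℝ} (h : ρ ≤ r) (hd : 0 ≤ dd) : Real.exp (-(r * dd)) ≤ Real.exp (-(ρ * dd)) :=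
  Real.exp_le_exp.mpr (by nlinarith)

omit [Fintype P] [DecidableEq P] in
/-- **(3.66) FOR THE CONCRETE `V′(A)` AND THE CONCRETE `G′(U′U)`, block functions on `(P, blkP)`** — gen 9's
`B9Ineq366Vprime.hasMajorant_cPrimeHom_vPrime` with the two-space letters `Q′, F′₂ : (T_η-functions) → (P-functions)`, `Q′*, F′₂*` back, and the
conclusion for the block map `blkP`: with `V′ := conj b (vPrimeConc T U η A …)` (the concrete (3.60)), `E := gPrimeExtEnd G′ (V′G′)` (the Neumann
series (3.64)), Theorem 3.1 (3.42)₁,₂ for `G′(U)` at rate `δ`, the concrete-`V′` data, Lemma 2.1 of [4] (transfers of `Lʲη`, `(Lʲη)²` at `α`,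
(2.61) at `(δ₀, β)` and `(ρ₁, α′)`), rates `ρ₁ + (α+β)δ₀ ≦ δ`, `ρ + (α+β)δ₀ ≦ (1−α′)ρ₁`, smallness `θ₃₆₃c₁(α′) < 1`: `C′(A)` has the majorant
`κ₃₆₆·α₁·(Lʲη)⁴·e^{−ρd(y,y′)}`, `κ₃₆₆`, `c_V`, `B₁` as there.  Proof verbatim, §2 in place of gen 6's `hasMajorant_cPrimeHom`.
[cite: Balaban1985BackgroundPropagators, (3.65)–(3.66) p.403 + (3.57)–(3.64) pp.401–402 + (3.42) p.397 + (3.19) p.393 + (3.37) p.396; Balaban1984PropagatorsII, Lemma 2.1 p.234 + (2.51)–(2.55) p.232 + (2.66) p.234] -/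
theorem hasMajorant_cPrimeHom_vPrime_blk (blk : S → g.Site) (blkP : P → g.Site) (d : ℕ) {η : ℝ} (hη : 0 < η) (A : κ → S → 𝔸)
    (kQ kF : g.Site → S → 𝔸 →L[ℝ] 𝔸) (sQ sF : S → 𝔸 →L[ℝ] 𝔸) (c w : g.Site → ℝ) (ρu d₀ M₂ C a₀ : ℝ)
    (δ₀ δ α β ρ₁ ρ Λ B₀ α₁ α' κQ cF : ℝ)
    (hB₀ : 0 ≤ B₀) (hα₁ : 0 ≤ α₁) (hΛ : 0 ≤ Λ) (hρ₁ : 0 ≤ ρ₁) (hρ : 0 ≤ ρ) (hα : 0 ≤ α) (hβ : 0 ≤ β) (hδ₀ : 0 ≤ δ₀)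
    (hδ : 0 ≤ δ) (hκQ : 0 ≤ κQ) (hcF : 0 ≤ cF)
    (hr1 : ρ₁ + (α + β) * δ₀ ≤ δ) (hα'0 : 0 ≤ α') (hα'1 : α' ≤ 1) (hr : ρ + (α + β) * δ₀ ≤ (1 - α') * ρ₁)
    (hdnn : ∀ a a' : g.Site, 0 ≤ g.dist a a') (hrefl : ∀ y : g.Site, g.dist y y = 0)
    (htri : Triangle254 (toB6 g Rr H)) (hlen : ∀ y : g.Site, 0 < g.len y)
    (h261 : Ineq261 d (toB6 g Rr H) δ₀ β) (h261' : Ineq261 d (toB6 g Rr H) ρ₁ α')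
    (hT1 : ScaleTransfer g δ₀ α Λ (fun a => g.len a)) (hT2 : ScaleTransfer g δ₀ α Λ (fun a => g.len a ^ 2))
    -- the concrete `V′`-letters
    (hM₂ : 0 ≤ M₂) (hrepr : ∀ (v : 𝔸) (i : ι), |b.repr v i| ≤ M₂ * ‖v‖)
    (hsmall : ∀ y : g.Site, η * (α₁ * (g.len y)⁻¹) ≤ 1 / 4)
    (hA : ∀ μ x, ‖A μ x‖ ≤ α₁ * (g.len (blk x))⁻¹ ∧ ‖tauB T U μ (A μ) x‖ ≤ α₁ * (g.len (blk x))⁻¹)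
    (h337s : ∀ μ x, ‖((η : ℂ)⁻¹) • covDstar T U μ (A μ) x‖ ≤ α₁ * (g.len (blk x) ^ 2)⁻¹)
    (hρu : ∀ μ x, ‖((U μ x : 𝔸ˣ) : 𝔸)‖ ≤ ρu ∧ ‖(((U μ x)⁻¹ : 𝔸ˣ) : 𝔸)‖ ≤ ρu)
    (hd₀ : ∀ μ x, g.dist (blk x) (blk (T μ x)) ≤ d₀ ∧ g.dist (blk x) (blk ((T μ).symm x)) ≤ d₀)
    (hd₀0 : ∀ y : g.Site, g.dist y y ≤ d₀)
    (hw : ∀ y, 0 ≤ w y) (hcard : ∀ y, ((B9Eq360Vprime.block blk y).card : ℝ) * w y ≤ 1) (hC : 0 ≤ C) (ha₀ : 0 ≤ a₀)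
    (hkQ : ∀ y x, blk x = y → ‖kQ y x‖ ≤ w y) (hkF : ∀ y x, blk x = y → ‖kF y x‖ ≤ C * α₁ * w y)
    (hsQ : ∀ x, ‖sQ x‖ ≤ 1) (hsF : ∀ x, ‖sF x‖ ≤ C * α₁) (hc : ∀ y, |c y| ≤ a₀ * (g.len y ^ 2)⁻¹)
    -- the smallness condition («for α₁ sufficiently small»)
    (hθ : theta363 (Fintype.card κ) ρu α₁ a₀ C M₂ (∑ i, ‖b i‖) (Real.exp (δ * d₀)) B₀ Λ (B6.c1 d δ₀ β) *
      B6.c1 d ρ₁ α' < 1)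
    -- Theorem 3.1 for `G′(U)` and the two-space letters
    {Gp : Module.End ℝ (S × ι → ℝ)}
    (h342_1 : HasMajorant (g := toB6 g Rr H) (fun p : S × ι => blk p.1) Gp
      (fun a a' => B₀ * g.len a ^ 2 * Real.exp (-(δ * g.dist a a'))))
    (h342_2 : ∀ k : κ ⊕ κ, HasMajorant (g := toB6 g Rr H) (fun p : S × ι => blk p.1)
      (conj b (diffLetter T U ((η : ℂ)⁻¹) k) * Gp) (fun a a' => B₀ * g.len a * Real.exp (-(δ * g.dist a a'))))
    {Q F₂ : (S × ι → ℝ) →ₗ[ℝ] (P → ℝ)} {Qs F₂s : (P → ℝ) →ₗ[ℝ] (S × ι → ℝ)}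
    (hQ : HasMajorantHom (g := toB6 g Rr H) (fun p : S × ι => blk p.1) blkP Q
      (fun a a' : g.Site => κQ * (if a = a' then (1 : ℝ) else 0)))
    (hQs : HasMajorantHom (g := toB6 g Rr H) blkP (fun p : S × ι => blk p.1) Qs
      (fun a a' : g.Site => κQ * (if a = a' then (1 : ℝ) else 0)))
    (hF : HasMajorantHom (g := toB6 g Rr H) (fun p : S × ι => blk p.1) blkP F₂
      (fun a a' : g.Site => cF * α₁ * (if a = a' then (1 : ℝ) else 0)))
    (hFs : HasMajorantHom (g := toB6 g Rr H) blkP (fun p : S × ι => blk p.1) F₂s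
      (fun a a' : g.Site => cF * α₁ * (if a = a' then (1 : ℝ) else 0))) :
    let V := conj b (vPrimeConc T U η A blk kQ kF sQ sF c)
    let E := gPrimeExtEnd Gp (V * Gp)
    let θ := theta363 (Fintype.card κ) ρu α₁ a₀ C M₂ (∑ i, ‖b i‖) (Real.exp (δ * d₀)) B₀ Λ (B6.c1 d δ₀ β)
    let c' := B6.c1 d ρ₁ α'
    let cV := kappa385 1 (cVConc (Fintype.card κ) ρu α₁ a₀ C M₂ (∑ i, ‖b i‖) (Real.exp (δ * d₀))) 0 0 Λ (B6.c1 d δ₀ β)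
    HasMajorant (g := toB6 g Rr H) blkP (cPrimeHom Q F₂ Qs F₂s Gp E V)
      (fun a a' => kappa366 κQ cF cV B₀ (B₀ * c' * (1 - θ * c')⁻¹) Λ (B6.c1 d δ₀ β) α₁ * α₁ * g.len a ^ 4 *
        Real.exp (-(ρ * g.dist a a'))) := by
  intro V E θ c' cV
  have hSb : 0 ≤ ∑ i, ‖b i‖ := Finset.sum_nonneg fun i _ => norm_nonneg _
  have hθ0 : 0 ≤ θ :=
    theta363_nonneg hα₁ ha₀ hC hM₂ hSb (Real.exp_nonneg _) hB₀ hΛ (c1_nonneg d δ₀ β)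
  have hc'0 : 0 ≤ c' := c1_nonneg d ρ₁ α'
  have hB₁ : 0 ≤ B₀ * c' * (1 - θ * c')⁻¹ := mul_nonneg (mul_nonneg hB₀ hc'0) (inv_nonneg.mpr (by linarith))
  have hcV0 : 0 ≤ cV :=
    kappa385_nonneg zero_le_one (cVConc_nonneg hα₁ ha₀ hC hM₂ hSb (Real.exp_nonneg _)) le_rfl le_rfl hΛ (c1_nonneg d δ₀ β)
  have hθeq : θ = cV * α₁ * B₀ := theta363_eq_cV _ _ _ _ _ _ _ _ _ _ _
  -- rates: r₀ := (1 − α′)ρ₁ ≤ ρ₁ ≤ δ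
  have hα'ρ : 0 ≤ (1 - α') * ρ₁ := mul_nonneg (by linarith) hρ₁
  have hr₀ρ₁ : (1 - α') * ρ₁ ≤ ρ₁ := by nlinarith
  have hρ₁δ : ρ₁ ≤ δ := by
    have : 0 ≤ (α + β) * δ₀ := by positivity
    linarith
  have hr₀δ : (1 - α') * ρ₁ ≤ δ := hr₀ρ₁.trans hρ₁δ
  -- the four decaying inputs of `hasMajorant_cPrimeHom_blk`, at the common rate r₀
  have hG : HasMajorant (g := toB6 g Rr H) (fun p : S × ι => blk p.1) Gp
      (fun a a' => B₀ * g.len a ^ 2 * Real.exp (-((1 - α') * ρ₁ * g.dist a a'))) :=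
    hasMajorant_mono (g := toB6 g Rr H) _ h342_1 fun a a' =>
      mul_le_mul_of_nonneg_left (exp_rate_le hr₀δ (hdnn a a')) (mul_nonneg hB₀ (sq_nonneg _))
  have hE : HasMajorant (g := toB6 g Rr H) (fun p : S × ι => blk p.1) E
      (fun a a' => B₀ * c' * (1 - θ * c')⁻¹ * g.len a ^ 2 * Real.exp (-((1 - α') * ρ₁ * g.dist a a'))) :=
    gpExt_entry1_vPrime b T U blk d hη A kQ kF sQ sF c w ρu d₀ M₂ C a₀ δ₀ δ α β ρ₁ Λ B₀ α₁ α' hB₀ hα₁ hΛ hρ₁ hα hβ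
      hδ₀ hδ hr1 hα'ρ hα'1 hdnn hrefl htri hlen h261 h261' hT1 hT2 hM₂ hrepr hsmall hA h337s hρu hd₀ hd₀0 hw hcard hC
      ha₀ hkQ hkF hsQ hsF hc hθ h342_1 h342_2
  have hVG : HasMajorant (g := toB6 g Rr H) (fun p : S × ι => blk p.1) (V * Gp)
      (fun a a' => cV * α₁ * B₀ * Real.exp (-((1 - α') * ρ₁ * g.dist a a'))) := by
    have h := ineq363_op_vPrime b T U blk d hη A kQ kF sQ sF c w ρu d₀ M₂ C a₀ δ₀ δ α β ρ₁ Λ B₀ α₁ hB₀ hα₁ hΛ hρ₁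
      hα hβ hδ₀ hδ hr1 hdnn htri hlen h261 hT1 hT2 hM₂ hrepr hsmall hA h337s hρu hd₀ hd₀0 hw hcard hC ha₀ hkQ hkF hsQ
      hsF hc h342_1 h342_2
    refine hasMajorant_mono (g := toB6 g Rr H) _ h fun a a' => ?_
    rw [show theta363 (Fintype.card κ) ρu α₁ a₀ C M₂ (∑ i, ‖b i‖) (Real.exp (δ * d₀)) B₀ Λ (B6.c1 d δ₀ β) = θ
      from rfl, hθeq]
    exact mul_le_mul_of_nonneg_left (exp_rate_le hr₀ρ₁ (hdnn a a')) (mul_nonneg (mul_nonneg hcV0 hα₁) hB₀)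
  have hVE : HasMajorant (g := toB6 g Rr H) (fun p : S × ι => blk p.1) (V * E)
      (fun a a' => cV * α₁ * (B₀ * c' * (1 - θ * c')⁻¹) * Real.exp (-((1 - α') * ρ₁ * g.dist a a'))) := by
    have h := hasMajorant_vPrime_gpExt b T U blk d hη A kQ kF sQ sF c w ρu d₀ M₂ C a₀ δ₀ δ α β ρ₁ Λ B₀ α₁ α' hB₀ hα₁
      hΛ hρ₁ hα hβ hδ₀ hδ hr1 hα'ρ hα'1 hdnn hrefl htri hlen h261 h261' hT1 hT2 hM₂ hrepr hsmall hA h337s hρu hd₀ hd₀0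
      hw hcard hC ha₀ hkQ hkF hsQ hsF hc hθ h342_1 h342_2
    refine hasMajorant_mono (g := toB6 g Rr H) _ h fun a a' => le_of_eq ?_
    rw [show theta363 (Fintype.card κ) ρu α₁ a₀ C M₂ (∑ i, ‖b i‖) (Real.exp (δ * d₀)) B₀ Λ (B6.c1 d δ₀ β) = θ
      from rfl, show B6.c1 d ρ₁ α' = c' from rfl, hθeq]
    ring
  exact hasMajorant_cPrimeHom_blk (R := Rr) (H := H) (fun p : S × ι => blk p.1) blkP d δ₀ ((1 - α') * ρ₁) α β ρ Λ κQ cF cV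
    B₀ (B₀ * c' * (1 - θ * c')⁻¹) α₁ hκQ hcF hcV0 hB₀ hB₁ hα₁ hΛ hρ (mul_nonneg hα hδ₀) (mul_nonneg hβ hδ₀) hr hdnn
    htri hT2 h261 hQ hQs hF hFs hG hE hVG hVE

/-- **B9 p. 403 «thus the operators in the equality are invertible and an inverse of the left-hand side can be expressed by a Neumann series
convergent for α₁ sufficiently small. … The inverse satisfies Theorem 3.2» — the `(Q′G′²Q′*)⁻¹`-CLAUSE OF THEOREM 3.4 FOR THE CONCRETE `V′(A)` of
(3.60) and the concrete `G′(U′U)` of (3.64), BLOCK FUNCTIONS ON `(P, blkP)`.**  Gen 9's `B9Ineq366Vprime.inverse_satisfies_thm32_vPrime` with: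
the (3.19)/(3.57)/(3.59) two-space letters into / out of the functions on `P`; THEOREM 3.2 for `U` as a right inverse `Linv` of
`L = Q′G′²(U)Q′*` on the functions on `P` with the BLOCK MAJORANT (3.48) `B_i(Lʲη)⁻⁴e^{−δ₀d(y,y′)}` for `blkP` (`h348`); the rest (concrete-`V′` data,
Theorem 3.1 (3.42)₁,₂ for `G′(U)`, Lemma 2.1 of [4] at the listed pairs, the rate condition `½δ₀ + (α+β)δ₀ ≦ (1−α′)ρ₁`, the smallness
`θ₃₆₃c₁(α′) < 1` and the EXPLICIT threshold `α₁ ≦ a₁ := (2κ₃₆₆B_ic₄c₁(δ₀,½+α_v)·c₁((½−α_v)δ₀,α₃))⁻¹`) verbatim.  CONCLUSION: `L′ = Q′(U′U)G′²(U′U)Q′*(U′U)`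
has a two-sided inverse on the functions on `P` with the block majorant `2B_ic₁((½−α_v)δ₀,α₃)(Lʲη)⁻⁴e^{−(1−α₃)(½−α_v)δ₀d(y,y′)}` for `blkP` —
(3.48) at `U′U`, constants as in the scalar clause.  Proof verbatim: (3.63) ⟹ ‖V′G′‖ < 1 ⟹ both forms of (3.65) (`eq365_end_left` / `eq365_end`),
`h365 := eq365b_hom`, `h366 :=` §3's (3.66) at `ρ = ½δ₀`, then §1's `inverse_satisfies_thm32_blk`.
[cite: Balaban1985BackgroundPropagators, Thm 3.2 (3.48) p.398 + (3.57)–(3.65) pp.401–402 + (3.65)–(3.67) p.403 + Thm 3.4 p.400 + (3.42) p.397; Balaban1984PropagatorsII, Lemma 2.1 p.234 + (2.51)–(2.55) p.232 + (2.66) p.234] -/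
theorem inverse_satisfies_thm32_vPrime_blk (blk : S → g.Site) (blkP : P → g.Site) (d : ℕ) {η : ℝ} (hη : 0 < η) (A : κ → S → 𝔸)
    (kQ kF : g.Site → S → 𝔸 →L[ℝ] 𝔸) (sQ sF : S → 𝔸 →L[ℝ] 𝔸) (c w : g.Site → ℝ) (ρu d₀ M₂ C a₀ : ℝ)
    (δ₀ δ α β ρ₁ Λ B₀ α₁ α' κQ cF αv α₃ c₄ Bi : ℝ)
    (hB₀ : 0 < B₀) (hα₁ : 0 ≤ α₁) (hΛ : 0 < Λ) (hρ₁ : 0 ≤ ρ₁) (hα : 0 ≤ α) (hβ : 0 ≤ β) (hδ₀ : 0 < δ₀)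
    (hδ : 0 ≤ δ) (hκQ : 0 < κQ) (hcF : 0 < cF) (hαv0 : 0 < αv) (hαv : αv < 1 / 2) (hα₃ : α₃ < 1) (hc₄ : 0 < c₄)
    (hBi : 0 < Bi)
    (hr1 : ρ₁ + (α + β) * δ₀ ≤ δ) (hα'0 : 0 ≤ α') (hα'1 : α' ≤ 1) (hr : δ₀ / 2 + (α + β) * δ₀ ≤ (1 - α') * ρ₁)
    (hc₁ : 0 < B6.c1 d δ₀ (1 / 2 + αv)) (hc₁' : 0 < B6.c1 d ((1 / 2 - αv) * δ₀) α₃) (hc₂ : 0 < B6.c1 d δ₀ β)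
    (hc' : 0 < B6.c1 d ρ₁ α')
    (hdnn : ∀ a a' : g.Site, 0 ≤ g.dist a a') (hrefl : ∀ y : g.Site, g.dist y y = 0)
    (hsym : ∀ y y' : g.Site, g.dist y y' = g.dist y' y)
    (htri : Triangle254 (toB6 g Rr H)) (hlen : ∀ y : g.Site, 0 < g.len y)
    (h261 : Ineq261 d (toB6 g Rr H) δ₀ β) (h261' : Ineq261 d (toB6 g Rr H) ρ₁ α')
    (h261v : Ineq261 d (toB6 g Rr H) δ₀ (1 / 2 + αv)) (h261v' : Ineq261 d (toB6 g Rr H) ((1 / 2 - αv) * δ₀) α₃)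
    (hT1 : ScaleTransfer g δ₀ α Λ (fun a => g.len a)) (hT2 : ScaleTransfer g δ₀ α Λ (fun a => g.len a ^ 2))
    (hT4 : ScaleTransfer g δ₀ αv c₄ (fun y => g.len y ^ (-(4 : ℝ))))
    -- the concrete `V′`-letters
    (hM₂ : 0 ≤ M₂) (hrepr : ∀ (v : 𝔸) (i : ι), |b.repr v i| ≤ M₂ * ‖v‖)
    (hsmall : ∀ y : g.Site, η * (α₁ * (g.len y)⁻¹) ≤ 1 / 4)
    (hA : ∀ μ x, ‖A μ x‖ ≤ α₁ * (g.len (blk x))⁻¹ ∧ ‖tauB T U μ (A μ) x‖ ≤ α₁ * (g.len (blk x))⁻¹)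
    (h337s : ∀ μ x, ‖((η : ℂ)⁻¹) • covDstar T U μ (A μ) x‖ ≤ α₁ * (g.len (blk x) ^ 2)⁻¹)
    (hρu : ∀ μ x, ‖((U μ x : 𝔸ˣ) : 𝔸)‖ ≤ ρu ∧ ‖(((U μ x)⁻¹ : 𝔸ˣ) : 𝔸)‖ ≤ ρu)
    (hd₀ : ∀ μ x, g.dist (blk x) (blk (T μ x)) ≤ d₀ ∧ g.dist (blk x) (blk ((T μ).symm x)) ≤ d₀)
    (hd₀0 : ∀ y : g.Site, g.dist y y ≤ d₀)
    (hw : ∀ y, 0 ≤ w y) (hcard : ∀ y, ((B9Eq360Vprime.block blk y).card : ℝ) * w y ≤ 1) (hC : 0 ≤ C) (ha₀ : 0 ≤ a₀)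
    (hkQ : ∀ y x, blk x = y → ‖kQ y x‖ ≤ w y) (hkF : ∀ y x, blk x = y → ‖kF y x‖ ≤ C * α₁ * w y)
    (hsQ : ∀ x, ‖sQ x‖ ≤ 1) (hsF : ∀ x, ‖sF x‖ ≤ C * α₁) (hc : ∀ y, |c y| ≤ a₀ * (g.len y ^ 2)⁻¹)
    -- the first smallness condition («for α₁ sufficiently small»: ‖V′G′‖ < 1)
    (hθ : theta363 (Fintype.card κ) ρu α₁ a₀ C M₂ (∑ i, ‖b i‖) (Real.exp (δ * d₀)) B₀ Λ (B6.c1 d δ₀ β) *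
      B6.c1 d ρ₁ α' < 1)
    -- Theorem 3.1 for `G′(U)`, the two-space letters, (3.57), Theorem 3.2 for `U`
    {Gp : Module.End ℝ (S × ι → ℝ)}
    (h342_1 : HasMajorant (g := toB6 g Rr H) (fun p : S × ι => blk p.1) Gp
      (fun a a' => B₀ * g.len a ^ 2 * Real.exp (-(δ * g.dist a a'))))
    (h342_2 : ∀ k : κ ⊕ κ, HasMajorant (g := toB6 g Rr H) (fun p : S × ι => blk p.1)
      (conj b (diffLetter T U ((η : ℂ)⁻¹) k) * Gp) (fun a a' => B₀ * g.len a * Real.exp (-(δ * g.dist a a'))))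
    {Q Q' F₂ : (S × ι → ℝ) →ₗ[ℝ] (P → ℝ)} {Qs Qs' F₂s : (P → ℝ) →ₗ[ℝ] (S × ι → ℝ)}
    (h357 : Q' = Q + F₂) (h357s : Qs' = Qs + F₂s)
    (hQ : HasMajorantHom (g := toB6 g Rr H) (fun p : S × ι => blk p.1) blkP Q
      (fun a a' : g.Site => κQ * (if a = a' then (1 : ℝ) else 0)))
    (hQs : HasMajorantHom (g := toB6 g Rr H) blkP (fun p : S × ι => blk p.1) Qs
      (fun a a' : g.Site => κQ * (if a = a' then (1 : ℝ) else 0)))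
    (hF : HasMajorantHom (g := toB6 g Rr H) (fun p : S × ι => blk p.1) blkP F₂
      (fun a a' : g.Site => cF * α₁ * (if a = a' then (1 : ℝ) else 0)))
    (hFs : HasMajorantHom (g := toB6 g Rr H) blkP (fun p : S × ι => blk p.1) F₂s
      (fun a a' : g.Site => cF * α₁ * (if a = a' then (1 : ℝ) else 0)))
    {Linv : Module.End ℝ (P → ℝ)} (hL : (Q ∘ₗ (Gp * Gp) ∘ₗ Qs) * Linv = 1)
    (h348 : HasMajorant (g := toB6 g Rr H) blkP Linv (fun a a' => Bi * g.len a ^ (-(4 : ℝ)) * Real.exp (-(δ₀ * g.dist a a')))) :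
    let V := conj b (vPrimeConc T U η A blk kQ kF sQ sF c)
    let E := gPrimeExtEnd Gp (V * Gp)
    let θ := theta363 (Fintype.card κ) ρu α₁ a₀ C M₂ (∑ i, ‖b i‖) (Real.exp (δ * d₀)) B₀ Λ (B6.c1 d δ₀ β)
    let c' := B6.c1 d ρ₁ α'
    let cV := kappa385 1 (cVConc (Fintype.card κ) ρu α₁ a₀ C M₂ (∑ i, ‖b i‖) (Real.exp (δ * d₀))) 0 0 Λ (B6.c1 d δ₀ β)
    let κ₆ := kappa366 κQ cF cV B₀ (B₀ * c' * (1 - θ * c')⁻¹) Λ (B6.c1 d δ₀ β) α₁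
    α₁ ≤ (2 * (κ₆ * Bi * c₄ * B6.c1 d δ₀ (1 / 2 + αv)) * B6.c1 d ((1 / 2 - αv) * δ₀) α₃)⁻¹ →
      ∃ Tinv : Module.End ℝ (P → ℝ),
        Tinv * (Q' ∘ₗ (E * E) ∘ₗ Qs') = 1 ∧ (Q' ∘ₗ (E * E) ∘ₗ Qs') * Tinv = 1 ∧
          HasMajorant (g := toB6 g Rr H) blkP Tinv (fun a a' =>
            2 * Bi * B6.c1 d ((1 / 2 - αv) * δ₀) α₃ * g.len a ^ (-(4 : ℝ)) *
              Real.exp (-((1 - α₃) * ((1 / 2 - αv) * δ₀) * g.dist a a'))) := by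
  intro V E θ c' cV κ₆ ha₁
  have hSb : 0 ≤ ∑ i, ‖b i‖ := Finset.sum_nonneg fun i _ => norm_nonneg _
  have hθ0 : 0 ≤ θ :=
    theta363_nonneg hα₁ ha₀ hC hM₂ hSb (Real.exp_nonneg _) hB₀.le hΛ.le (c1_nonneg d δ₀ β)
  have hcV0 : 0 ≤ cV :=
    kappa385_nonneg zero_le_one (cVConc_nonneg hα₁ ha₀ hC hM₂ hSb (Real.exp_nonneg _)) le_rfl le_rfl hΛ.le (c1_nonneg d δ₀ β)
  have hB₁ : 0 < B₀ * c' * (1 - θ * c')⁻¹ := mul_pos (mul_pos hB₀ hc') (inv_pos.mpr (by linarith))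
  have hκ : 0 < κ₆ := kappa366_pos hκQ hcF hcV0 hB₁ hΛ hc₂ hα₁
  have hα'ρ : 0 ≤ (1 - α') * ρ₁ := mul_nonneg (by linarith) hρ₁
  -- (3.63) for the concrete V′ and ‖V′G′‖ < 1, hence the two forms of (3.65) for E
  have h363 : HasMajorant (g := toB6 g Rr H) (fun p : S × ι => blk p.1) (V * Gp)
      (fun a a' => θ * Real.exp (-(ρ₁ * g.dist a a'))) :=
    ineq363_op_vPrime b T U blk d hη A kQ kF sQ sF c w ρu d₀ M₂ C a₀ δ₀ δ α β ρ₁ Λ B₀ α₁ hB₀.le hα₁ hΛ.le hρ₁ hα hβ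
      hδ₀.le hδ hr1 hdnn htri hlen h261 hT1 hT2 hM₂ hrepr hsmall hA h337s hρu hd₀ hd₀0 hw hcard hC ha₀ hkQ hkF hsQ hsF
      hc h342_1 h342_2
  have hW : ‖B9Eq360Vprime.toCLM (V * Gp)‖ < 1 :=
    opNorm_lt_one_of_363_261 (g := toB6 g Rr H) (fun p : S × ι => blk p.1) d ρ₁ α' θ hθ0 hα'ρ hdnn h261' hθ h363
  have h365l : E = Gp + Gp * V * E := eq365_end_left Gp V hW
  have h365r : E = Gp + E * V * Gp := by
    have h := eq365_end Gp (V * Gp) hW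
    rwa [← mul_assoc] at h
  have h365 : Q' ∘ₗ (E * E) ∘ₗ Qs' = Q ∘ₗ (Gp * Gp) ∘ₗ Qs + cPrimeHom Q F₂ Qs F₂s Gp E V :=
    eq365b_hom Q Q' F₂ Qs Qs' F₂s Gp E V h357 h357s h365l h365r
  -- (3.66) at the printed rate ½δ₀, block-majorant form with the real power (Lʲη)⁴
  have h366 := hasMajorant_cPrimeHom_vPrime_blk b T U blk blkP d hη A kQ kF sQ sF c w ρu d₀ M₂ C a₀ δ₀ δ α β ρ₁ (δ₀ / 2) Λ B₀
    α₁ α' κQ cF hB₀.le hα₁ hΛ.le hρ₁ (by linarith) hα hβ hδ₀.le hδ hκQ.le hcF.le hr1 hα'0 hα'1 hr hdnn hrefl htri hlen h261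
    h261' hT1 hT2 hM₂ hrepr hsmall hA h337s hρu hd₀ hd₀0 hw hcard hC ha₀ hkQ hkF hsQ hsF hc hθ h342_1 h342_2 hQ hQs hF hFs
  have h366' : HasMajorant (g := toB6 g Rr H) blkP (cPrimeHom Q F₂ Qs F₂s Gp E V)
      (fun a a' => κ₆ * α₁ * g.len a ^ (4 : ℝ) * Real.exp (-(δ₀ / 2 * g.dist a a'))) := by
    refine hasMajorant_mono (g := toB6 g Rr H) _ h366 fun a a' => le_of_eq ?_
    have h4 : g.len a ^ (4 : ℝ) = g.len a ^ 4 := by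
      rw [show (4 : ℝ) = ((4 : ℕ) : ℝ) by norm_num, Real.rpow_natCast]
    rw [h4]
  have hmul : (Q ∘ₗ (Gp * Gp) ∘ₗ Qs : Module.End ℝ (P → ℝ)) * Linv = 1 := hL
  exact inverse_satisfies_thm32_blk (R := Rr) (H := H) blkP d δ₀ αv α₃ κ₆ Bi c₄ α₁ hδ₀ hαv0 hαv hα₃ hκ hBi hc₄ hα₁ hc₁ hc₁' htri
    hsym hrefl hdnn hlen hT4 h261v h261v' ha₁ hmul h348 h365 h366'

end Concrete

/-! ## §4  THEOREM 3.4, the `(Q′G′²Q′*)⁻¹(U′U)`-clause with `a₁` chosen before the lattice, block functions on `(P, blkP)` -/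

section CInv

variable {𝔸 : Type*} [NormedRing 𝔸] [NormedAlgebra ℂ 𝔸] [CompleteSpace 𝔸] {ι : Type} [Fintype ι]
variable (b : Module.Basis ι ℝ 𝔸) (κ : Type) [Fintype κ]

set_option maxHeartbeats 800000 in
/-- ★ **THEOREM 3.4, `(Q′G′²Q′*)⁻¹(U′U)`-CLAUSE, THRESHOLD BEFORE THE LATTICE, FOR BLOCK FUNCTIONS ON A GENERAL BLOCK CARRIER `(P, blkP : P → 𝔅)`**
(p. 400 l.7–10 «There exists a positive constant a₁ such that the operators G′(U), (Q′(U)G′²(U)Q′*(U))⁻¹, … extend to configurations U′U for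
α₁ ≦ a₁ … The extended operators satisfy all the inequalities of Theorems 3.1–3.3 correspondingly»; p. 403 «… The inverse satisfies Theorem
3.2»; p. 399 «the constants … do not depend on the sequence {Ω_j}»; (3.8) p. 392: the averaged fields take values in 𝔤).  For fixed `d`, `κ`,
`(𝔸, b, M₂)`, input constants `δ₀, κ_Q, B_G, B₁, c_F, C_q, a₀, d₀` and ONE scale-transfer function `Λ(·) ≧ 1`, THERE EXISTS `a₁ > 0` such that FOR
EVERY lattice `(S, T)`, geometry `𝔅 = g` with site block map `blk` AND EVERY FINITE BLOCK CARRIER `P` with block map `blkP : P → 𝔅` (axioms,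
[4] (2.61) at `δ₀` and the p. 398 scale transfer with `Λ(α)` for every exponent `9/5000 ≦ α (< 1)`), background `U`, (3.19)/(3.60) data, `G′(U)`
with Theorem 3.1 (3.42)₁,₂ at `(B_G, δ₀)`, (3.19) letters `Q′ : (S × ι → ℝ) →ₗ (P → ℝ)`, `Q′* : (P → ℝ) →ₗ (S × ι → ℝ)` (block-local, constant
`κ_Q`) and `C⁻¹(U)`, right inverse of `Q′G′²Q′*` on the functions on `P`, with Theorem 3.2's bound (3.48) as the BLOCK MAJORANT
`B₁(Lʲη)⁻⁴e^{−δ₀d(y,y′)}` for `blkP`: for all `0 ≦ α₁ ≦ a₁`, all `A` in (3.37) (blockwise), (3.59) kernels and (3.57)/(3.59) letters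
`Q′(U′U) = Q′ + F′₂`, `Q′*(U′U) = Q′* + F′₂*` of size `c_Fα₁`, THERE EXISTS `C⁻¹(U′U)`, two-sided inverse of `Q′(U′U)G′²(U′U)Q′*(U′U)` on the
functions on `P`, with the block majorant `2B₁c₁(2δ₀/5, 1/10)·(Lʲη)⁻⁴·e^{−(9δ₀/25)d(y,y′)}` for `blkP` — constant AND threshold free of the lattice
AND of `P`, and LITERALLY those of the scalar clause `B9Thm34SectBUniformR1.thm34_Cinv_uniform` (the case `P = 𝔅`, `blkP = id`, via
`B9Thm34Inv.hasMajorant_id_iff` / `ker_le_iff`).  PROOF = FILE 45-R1 §2 verbatim with §3's `inverse_satisfies_thm32_vPrime_blk`.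
[cite: Balaban1985BackgroundPropagators, Thm 3.4 p.400 + p.399 + Thm 3.2 (3.48) p.398 + p.403 + (3.8) p.392 + (3.57) p.401 + (3.58)–(3.67) pp.402–403 + (3.19)/(3.21) pp.393–394 + Thm 3.1 (3.42) p.397 + (3.37) p.396; Balaban1984PropagatorsII, Lemma 2.1 p.234 + (2.51)–(2.55) p.232 + (2.66) p.234] -/
theorem thm34_Cinv_uniform_blk [DecidableEq ι] (d : ℕ) (δ₀ κQ BG B₁ cF Cq a₀ d₀ M₂ : ℝ) (Λf : ℝ → ℝ)
    (hκQ : 0 < κQ) (hBG : 0 < BG) (hB₁ : 0 < B₁) (hcF : 0 < cF) (hCq : 0 ≤ Cq) (ha₀ : 0 ≤ a₀) (hM₂ : 0 ≤ M₂) (hδ₀ : 0 < δ₀)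
    (hΛf : ∀ α : ℝ, 0 < α → 1 ≤ Λf α) (hrepr : ∀ (v : 𝔸) (i : ι), |b.repr v i| ≤ M₂ * ‖v‖) :
    ∃ a₁ : ℝ, 0 < a₁ ∧
    ∀ {S : Type} [Fintype S] [DecidableEq S] (T : κ → Equiv.Perm S) (U : κ → S → 𝔸ˣ)
      {g : B9.Geometry} [Fintype g.Site] [DecidableEq g.Site] [Nonempty g.Site] {Rr : ℝ} {H : Prop} (blk : S → g.Site)
      {P : Type} [Fintype P] [DecidableEq P] (blkP : P → g.Site)
      (kQ : g.Site → S → 𝔸 →L[ℝ] 𝔸) (sQ : S → 𝔸 →L[ℝ] 𝔸) (cfun w : g.Site → ℝ),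
    -- the multiscale geometry 𝔅 (p. 393, [4] (2.1)–(2.4)) and its axioms
      (∀ a a' : g.Site, 0 ≤ g.dist a a') → Triangle254 (toB6 g Rr H) → (∀ y : g.Site, g.dist y y = 0) →
      (∀ y y' : g.Site, g.dist y y' = g.dist y' y) → (∀ y : g.Site, 0 < g.len y) → (∀ y : g.Site, g.eta ≤ g.len y) → 0 < g.eta →
    -- [4] Lemma 2.1 (2.61) at the rate `δ₀` and the p. 398 scale transfer with the constant `Λ(α)`, for every exponent `9/5000 ≤ α (< 1)` (R1 window)
      (∀ α : ℝ, 9 / 5000 ≤ α → α < 1 → Ineq261 d (toB6 g Rr H) δ₀ α) →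
      (∀ α : ℝ, 9 / 5000 ≤ α → ScaleTransfer g δ₀ α (Λf α) (fun a => g.len a) ∧ ScaleTransfer g δ₀ α (Λf α) (fun a => g.len a ^ 2) ∧
        ScaleTransfer g δ₀ α (Λf α) (fun a => (g.len a)⁻¹) ∧ ScaleTransfer g δ₀ α (Λf α) (fun a => (g.len a ^ 2)⁻¹) ∧
        ScaleTransfer g δ₀ α (Λf α) (fun a => (g.len a ^ 4)⁻¹) ∧ ScaleTransfer g δ₀ α (Λf α) (fun y => g.len y ^ (-(4 : ℝ)))) →
    -- unitary-type background, stencil geometry at range `d₀`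
      (∀ m z, ‖((U m z : 𝔸ˣ) : 𝔸)‖ ≤ 1 ∧ ‖(((U m z)⁻¹ : 𝔸ˣ) : 𝔸)‖ ≤ 1) →
      (∀ μ x, g.dist (blk x) (blk ((T μ).symm x)) ≤ d₀) → (∀ μ x, g.dist (blk x) (blk (T μ x)) ≤ d₀) →
      (∀ y : g.Site, g.dist y y ≤ d₀) →
    -- the `A`-independent data of the concrete `V′(A)` of (3.60)
      (∀ y, 0 ≤ w y) → (∀ y, ((B9Eq360Vprime.block blk y).card : ℝ) * w y ≤ 1) →
      (∀ y x, blk x = y → ‖kQ y x‖ ≤ w y) → (∀ x, ‖sQ x‖ ≤ 1) → (∀ y, |cfun y| ≤ a₀ * (g.len y ^ 2)⁻¹) →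
    -- THEOREM 3.1 for `G′(U)`: (3.42)₁,₂ at the rate `δ₀`
    ∀ {Gp : Module.End ℝ (S × ι → ℝ)},
      HasMajorant (g := toB6 g Rr H) (fun p : S × ι => blk p.1) Gp (fun a a' => BG * g.len a ^ 2 * Real.exp (-(δ₀ * g.dist a a'))) →
      (∀ k : κ ⊕ κ, HasMajorant (g := toB6 g Rr H) (fun p : S × ι => blk p.1)
        (conj b (diffLetter T U ((g.eta : ℂ)⁻¹) k) * Gp) (fun a a' => BG * g.len a * Real.exp (-(δ₀ * g.dist a a')))) →
    -- the (3.19) letters `Q′(U)`, `Q′*(U)` between the site functions and the functions on `P`, block-local two-space majorants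
    ∀ {Qc : (S × ι → ℝ) →ₗ[ℝ] (P → ℝ)} {Qcs : (P → ℝ) →ₗ[ℝ] (S × ι → ℝ)} {Linv : Module.End ℝ (P → ℝ)},
      HasMajorantHom (g := toB6 g Rr H) (fun p : S × ι => blk p.1) blkP Qc
        (fun a a' : g.Site => κQ * (if a = a' then (1 : ℝ) else 0)) →
      HasMajorantHom (g := toB6 g Rr H) blkP (fun p : S × ι => blk p.1) Qcs
        (fun a a' : g.Site => κQ * (if a = a' then (1 : ℝ) else 0)) →
    -- THEOREM 3.2 for `U`: (3.21) `C⁻¹ = (Q′G′²Q′*)⁻¹` exists with (3.48) at the rate `δ₀`, as a block majorant for `blkP`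
      (Qc ∘ₗ (Gp * Gp) ∘ₗ Qcs) * Linv = 1 →
      HasMajorant (g := toB6 g Rr H) blkP Linv (fun a a' => B₁ * g.len a ^ (-(4 : ℝ)) * Real.exp (-(δ₀ * g.dist a a'))) →
    ∀ (α₁ : ℝ), 0 ≤ α₁ → α₁ ≤ a₁ →
    ∀ (A : κ → S → 𝔸) (kF : g.Site → S → 𝔸 →L[ℝ] 𝔸) (sF : S → 𝔸 →L[ℝ] 𝔸),
      (∀ y x, blk x = y → ‖kF y x‖ ≤ Cq * α₁ * w y) → (∀ x, ‖sF x‖ ≤ Cq * α₁) →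
      (∀ ν k x, ‖((g.eta : ℂ)⁻¹) • covDstar T U ν (A k) x‖ ≤ α₁ * (g.len (blk x) ^ 2)⁻¹) →
      (∀ k x, ‖A k x‖ ≤ α₁ * (g.len (blk x))⁻¹) → (∀ ν k x, ‖tauB T U ν (A k) x‖ ≤ α₁ * (g.len (blk x))⁻¹) →
    ∀ {Qc' Fc : (S × ι → ℝ) →ₗ[ℝ] (P → ℝ)} {Qcs' Fcs : (P → ℝ) →ₗ[ℝ] (S × ι → ℝ)},
      Qc' = Qc + Fc → Qcs' = Qcs + Fcs →
      HasMajorantHom (g := toB6 g Rr H) (fun p : S × ι => blk p.1) blkP Fc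
        (fun a a' : g.Site => cF * α₁ * (if a = a' then (1 : ℝ) else 0)) →
      HasMajorantHom (g := toB6 g Rr H) blkP (fun p : S × ι => blk p.1) Fcs
        (fun a a' : g.Site => cF * α₁ * (if a = a' then (1 : ℝ) else 0)) →
    ∃ Tinv : Module.End ℝ (P → ℝ),
      Tinv * (Qc' ∘ₗ ((gPrimeExtEnd Gp (conj b (vPrimeConc T U g.eta A blk kQ kF sQ sF cfun) * Gp)) * (gPrimeExtEnd Gp (conj b (vPrimeConc T U g.eta A blk kQ kF sQ sF cfun) * Gp))) ∘ₗ Qcs') = 1 ∧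
      (Qc' ∘ₗ ((gPrimeExtEnd Gp (conj b (vPrimeConc T U g.eta A blk kQ kF sQ sF cfun) * Gp)) * (gPrimeExtEnd Gp (conj b (vPrimeConc T U g.eta A blk kQ kF sQ sF cfun) * Gp))) ∘ₗ Qcs') * Tinv = 1 ∧
      HasMajorant (g := toB6 g Rr H) blkP Tinv (fun a a' =>
        2 * B₁ * B6.c1 d (2 / 5 * δ₀) (1 / 10) * g.len a ^ (-(4 : ℝ)) * Real.exp (-(9 / 25 * δ₀ * g.dist a a'))) := by
  classical
  have hSb : 0 ≤ ∑ i, ‖b i‖ := Finset.sum_nonneg fun i _ => norm_nonneg _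
  -- the two scale-transfer constants of the chain, READ FROM THE GIVEN FUNCTION `Λ(·)` (lattice-free)
  have hΛ : 1 ≤ Λf (1 / 100) := hΛf _ (by norm_num)
  have hc₄1 : 1 ≤ Λf (1 / 10) := hΛf _ (by norm_num)
  have hΛ0 : 0 < Λf (1 / 100) := zero_lt_one.trans_le hΛ
  have hc₄ : 0 < Λf (1 / 10) := zero_lt_one.trans_le hc₄1
  -- «for α₁ sufficiently small» (p. 403): the two threshold functions of the chain are continuous at `α₁ = 0` and vanish there — NO
  -- lattice datum (and no block-carrier datum) enters
  obtain ⟨ε₁, hε₁, hF1⟩ := exists_threshold_of_continuousAt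
    (f := fun α₁ : ℝ => theta363 (Fintype.card κ) 1 α₁ a₀ Cq M₂ (∑ i, ‖b i‖) (Real.exp (δ₀ * d₀)) BG (Λf (1 / 100)) (B6.c1 d δ₀ (1 / 100)) *
      B6.c1 d (49 / 50 * δ₀) (1 / 100))
    (by unfold theta363 kappa385 cVConc cBConc; fun_prop) (by simp [theta363])
  obtain ⟨ε₅, hε₅, hF5⟩ := exists_threshold_of_continuousAt
    (f := fun α₁ : ℝ => α₁ * (2 * (kappa366 κQ cF (kappa385 1 (cVConc (Fintype.card κ) 1 α₁ a₀ Cq M₂ (∑ i, ‖b i‖) (Real.exp (δ₀ * d₀))) 0 0 (Λf (1 / 100)) (B6.c1 d δ₀ (1 / 100))) BG (BG * B6.c1 d (49 / 50 * δ₀) (1 / 100) * (1 - theta363 (Fintype.card κ) 1 α₁ a₀ Cq M₂ (∑ i, ‖b i‖) (Real.exp (δ₀ * d₀)) BG (Λf (1 / 100)) (B6.c1 d δ₀ (1 / 100)) * B6.c1 d (49 / 50 * δ₀) (1 / 100))⁻¹) (Λf (1 / 100)) (B6.c1 d δ₀ (1 / 100)) α₁ * B₁ * Λf (1 / 10) *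 B6.c1 d δ₀ (1 / 2 + 1 / 10)) * B6.c1 d ((1 / 2 - 1 / 10) * δ₀) (1 / 10)))
    (by
      unfold theta363 kappa366 kappa385 cVConc cBConc
      fun_prop (disch := simp))
    (by simp)
  refine ⟨min (min ε₁ ε₅) (1 / 2) / 2, half_pos (lt_min (lt_min hε₁ hε₅) one_half_pos), ?_⟩
  -- NOW the lattice, the block carrier, the background, the data and Theorems 3.1/3.2 for `U`
  intro S _ _ T U g _ _ _ Rr H blk P _ _ blkP kQ sQ cfun w hdnn htri hrefl hsym hlen hlenη hη h261 hST hU1 hd₀B hd₀F hd₀0 hw hcard hkQ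
    hsQ hcfun Gp h342_1 h342_2 Qc Qcs Linv hQc hQcs hLinv h348 α₁ hα₁0 hα₁1 A kF sF hkF hsF h337B hA hAτB Qc' Fc Qcs' Fcs h357 h357s hFc hFcs
  obtain ⟨y₀⟩ := ‹Nonempty g.Site›
  -- the p. 398 scale transfers and [4] Lemma 2.1 at the pairs of the `C⁻¹(U′U)`-chain
  obtain ⟨hT1, hT2, -, -, -, -⟩ := hST (1 / 100) (by norm_num)
  obtain ⟨-, -, -, -, -, hT4v⟩ := hST (1 / 10) (by norm_num)
  have h261β : Ineq261 d (toB6 g Rr H) δ₀ (1 / 100) := h261 _ (by norm_num) (by norm_num)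
  have h261c : Ineq261 d (toB6 g Rr H) (49 / 50 * δ₀) (1 / 100) :=
    ineq261_rescale (h261 (1 / 100 * (49 / 50)) (by norm_num) (by norm_num))
  have h261v : Ineq261 d (toB6 g Rr H) δ₀ (1 / 2 + 1 / 10) := h261 _ (by norm_num) (by norm_num)
  have h261v' : Ineq261 d (toB6 g Rr H) ((1 / 2 - 1 / 10) * δ₀) (1 / 10) :=
    ineq261_rescale (h261 (1 / 10 * (1 / 2 - 1 / 10)) (by norm_num) (by norm_num))
  have hc₂ : 0 < B6.c1 d δ₀ (1 / 100) := c1_pos_of_ineq261 h261β y₀ (hrefl y₀)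
  have hcc' : 0 < B6.c1 d (49 / 50 * δ₀) (1 / 100) := c1_pos_of_ineq261 h261c y₀ (hrefl y₀)
  have hc₁v : 0 < B6.c1 d δ₀ (1 / 2 + 1 / 10) := c1_pos_of_ineq261 h261v y₀ (hrefl y₀)
  have hc₁v' : 0 < B6.c1 d ((1 / 2 - 1 / 10) * δ₀) (1 / 10) := c1_pos_of_ineq261 h261v' y₀ (hrefl y₀)
  have hrc1 : 49 / 50 * δ₀ + (1 / 100 + 1 / 100) * δ₀ ≤ δ₀ := by linarith only [hδ₀]
  have hrc : δ₀ / 2 + (1 / 100 + 1 / 100) * δ₀ ≤ (1 - 1 / 100) * (49 / 50 * δ₀) := by linarith only [hδ₀]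
  have hρc0 : 0 ≤ 49 / 50 * δ₀ := by linarith only [hδ₀]
  have hmε₁ : min (min ε₁ ε₅) (1 / 2) ≤ ε₁ := (min_le_left _ _).trans (min_le_left _ _)
  have hmε₅ : min (min ε₁ ε₅) (1 / 2) ≤ ε₅ := (min_le_left _ _).trans (min_le_right _ _)
  have hmh : min (min ε₁ ε₅) (1 / 2) ≤ 1 / 2 := min_le_right _ _
  have habs : |α₁| = α₁ := abs_of_nonneg hα₁0
  have h1 : theta363 (Fintype.card κ) 1 α₁ a₀ Cq M₂ (∑ i, ‖b i‖) (Real.exp (δ₀ * d₀)) BG (Λf (1 / 100)) (B6.c1 d δ₀ (1 / 100)) *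
      B6.c1 d (49 / 50 * δ₀) (1 / 100) < 1 / 2 :=
    hF1 α₁ (by rw [habs]; linarith only [hα₁1, hmε₁, hε₁])
  have h5 : α₁ * (2 * (kappa366 κQ cF (kappa385 1 (cVConc (Fintype.card κ) 1 α₁ a₀ Cq M₂ (∑ i, ‖b i‖) (Real.exp (δ₀ * d₀))) 0 0 (Λf (1 / 100)) (B6.c1 d δ₀ (1 / 100))) BG (BG * B6.c1 d (49 / 50 * δ₀) (1 / 100) * (1 - theta363 (Fintype.card κ) 1 α₁ a₀ Cq M₂ (∑ i, ‖b i‖) (Real.exp (δ₀ * d₀)) BG (Λf (1 / 100)) (B6.c1 d δ₀ (1 / 100)) * B6.c1 d (49 / 50 * δ₀) (1 / 100))⁻¹) (Λf (1 / 100)) (B6.c1 d δ₀ (1 / 100)) α₁ * B₁ * Λf (1 / 10) * B6.c1 d δ₀ (1 / 2 + 1 / 10)) * B6.c1 d ((1 / 2 - 1 / 10) * δ₀) (1 / 10)) < 1 / 2 :=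
    hF5 α₁ (by rw [habs]; linarith only [hα₁1, hmε₅, hε₅])
  have hhalf : (1 / 2 : ℝ) < 1 := by norm_num
  -- `η·α₁(Lʲη)⁻¹ ≦ 1/4` from `α₁ ≦ 1/4` and `η ≦ Lʲη`
  have hsmall : ∀ y : g.Site, g.eta * (α₁ * (g.len y)⁻¹) ≤ 1 / 4 := fun y => by
    have hq : g.eta * (g.len y)⁻¹ ≤ 1 := by
      rw [← div_eq_mul_inv]; exact (div_le_one (hlen y)).mpr (hlenη y)
    calc g.eta * (α₁ * (g.len y)⁻¹) = α₁ * (g.eta * (g.len y)⁻¹) := by ring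
      _ ≤ α₁ * 1 := mul_le_mul_of_nonneg_left hq hα₁0
      _ ≤ 1 / 4 := by linarith only [hα₁1, hmh]
  -- signs of the explicit constants at this `α₁`, and the explicit threshold `ha₁'`
  have hcV0E : ∀ E : ℝ, 0 ≤ E →
      0 ≤ kappa385 1 (cVConc (Fintype.card κ) 1 α₁ a₀ Cq M₂ (∑ i, ‖b i‖) E) 0 0 (Λf (1 / 100)) (B6.c1 d δ₀ (1 / 100)) := fun E hE =>
    kappa385_nonneg zero_le_one (cVConc_nonneg hα₁0 ha₀ hCq hM₂ hSb hE) le_rfl le_rfl hΛ0.le hc₂.le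
  have hNc : 0 < BG * B6.c1 d (49 / 50 * δ₀) (1 / 100) * (1 - theta363 (Fintype.card κ) 1 α₁ a₀ Cq M₂ (∑ i, ‖b i‖) (Real.exp (δ₀ * d₀)) BG (Λf (1 / 100)) (B6.c1 d δ₀ (1 / 100)) * B6.c1 d (49 / 50 * δ₀) (1 / 100))⁻¹ :=
    mul_pos (mul_pos hBG hcc') (inv_pos.mpr (by linarith only [h1]))
  have hκC0 : 0 < kappa366 κQ cF (kappa385 1 (cVConc (Fintype.card κ) 1 α₁ a₀ Cq M₂ (∑ i, ‖b i‖) (Real.exp (δ₀ * d₀))) 0 0 (Λf (1 / 100)) (B6.c1 d δ₀ (1 / 100))) BG (BG * B6.c1 d (49 / 50 * δ₀) (1 / 100) * (1 - theta363 (Fintype.card κ) 1 α₁ a₀ Cq M₂ (∑ i, ‖b i‖) (Real.exp (δ₀ * d₀)) BG (Λf (1 / 100)) (B6.c1 d δ₀ (1 / 100)) * B6.c1 d (49 / 50 * δ₀) (1 / 100))⁻¹) (Λf (1 / 100)) (B6.c1 d δ₀ (1 / 100)) α₁ :=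
    kappa366_pos hκQ hcF (hcV0E _ (Real.exp_nonneg _)) hNc hΛ0 hc₂ hα₁0
  have hXpos : 0 < 2 * (kappa366 κQ cF (kappa385 1 (cVConc (Fintype.card κ) 1 α₁ a₀ Cq M₂ (∑ i, ‖b i‖) (Real.exp (δ₀ * d₀))) 0 0 (Λf (1 / 100)) (B6.c1 d δ₀ (1 / 100))) BG (BG * B6.c1 d (49 / 50 * δ₀) (1 / 100) * (1 - theta363 (Fintype.card κ) 1 α₁ a₀ Cq M₂ (∑ i, ‖b i‖) (Real.exp (δ₀ * d₀)) BG (Λf (1 / 100)) (B6.c1 d δ₀ (1 / 100)) * B6.c1 d (49 / 50 * δ₀) (1 / 100))⁻¹) (Λf (1 / 100)) (B6.c1 d δ₀ (1 / 100)) α₁ * B₁ * Λf (1 / 10) * B6.c1 d δ₀ (1 / 2 + 1 / 10)) * B6.c1 d ((1 / 2 - 1 / 10) * δ₀) (1 / 10) :=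
    mul_pos (mul_pos two_pos (mul_pos (mul_pos (mul_pos hκC0 hB₁) hc₄) hc₁v)) hc₁v'
  have ha₁' : α₁ ≤ (2 * (kappa366 κQ cF (kappa385 1 (cVConc (Fintype.card κ) 1 α₁ a₀ Cq M₂ (∑ i, ‖b i‖) (Real.exp (δ₀ * d₀))) 0 0 (Λf (1 / 100)) (B6.c1 d δ₀ (1 / 100))) BG (BG * B6.c1 d (49 / 50 * δ₀) (1 / 100) * (1 - theta363 (Fintype.card κ) 1 α₁ a₀ Cq M₂ (∑ i, ‖b i‖) (Real.exp (δ₀ * d₀)) BG (Λf (1 / 100)) (B6.c1 d δ₀ (1 / 100)) * B6.c1 d (49 / 50 * δ₀) (1 / 100))⁻¹) (Λf (1 / 100)) (B6.c1 d δ₀ (1 / 100)) α₁ * B₁ * Λf (1 / 10) * B6.c1 d δ₀ (1 / 2 + 1 / 10)) * B6.c1 d ((1 / 2 - 1 / 10) * δ₀) (1 / 10))⁻¹ := by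
    rw [inv_eq_one_div, le_div_iff₀ hXpos]; linarith only [h5]
  -- the shapes gen 9's `B9Ineq363Vprime` reads (3.37) / the stencil geometry in
  have hA' : ∀ μ x, ‖A μ x‖ ≤ α₁ * (g.len (blk x))⁻¹ ∧ ‖tauB T U μ (A μ) x‖ ≤ α₁ * (g.len (blk x))⁻¹ :=
    fun μ x => ⟨hA μ x, hAτB μ μ x⟩
  have h337s' : ∀ μ x, ‖((g.eta : ℂ)⁻¹) • covDstar T U μ (A μ) x‖ ≤ α₁ * (g.len (blk x) ^ 2)⁻¹ := fun μ x => h337B μ μ x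
  have hd₀' : ∀ μ x, g.dist (blk x) (blk (T μ x)) ≤ d₀ ∧ g.dist (blk x) (blk ((T μ).symm x)) ≤ d₀ :=
    fun μ x => ⟨hd₀F μ x, hd₀B μ x⟩
  -- «The inverse satisfies Theorem 3.2» (§3)
  obtain ⟨Tinv, hTl, hTr, hTker⟩ := inverse_satisfies_thm32_vPrime_blk (Rr := Rr) (H := H) b T U blk blkP d hη A kQ kF sQ sF cfun w 1 d₀ M₂
    Cq a₀ δ₀ δ₀ (1 / 100) (1 / 100) (49 / 50 * δ₀) (Λf (1 / 100)) BG α₁ (1 / 100) κQ cF (1 / 10) (1 / 10) (Λf (1 / 10)) B₁ hBG hα₁0 hΛ0 hρc0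
    (by norm_num) (by norm_num) hδ₀ hδ₀.le hκQ hcF (by norm_num) (by norm_num) (by norm_num) hc₄ hB₁ hrc1 (by norm_num) (by norm_num) hrc
    hc₁v hc₁v' hc₂ hcc' hdnn hrefl hsym htri hlen h261β h261c h261v h261v' hT1 hT2 hT4v hM₂ hrepr hsmall hA' h337s' hU1 hd₀' hd₀0 hw
    hcard hCq ha₀ hkQ hkF hsQ hsF hcfun (h1.trans hhalf) h342_1 h342_2 h357 h357s hQc hQcs hFc hFcs hLinv h348 ha₁'
  refine ⟨Tinv, hTl, hTr, hasMajorant_mono (g := toB6 g Rr H) _ hTker fun y y' => le_of_eq ?_⟩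
  have e1 : B6.c1 d ((1 / 2 - 1 / 10) * δ₀) (1 / 10) = B6.c1 d (2 / 5 * δ₀) (1 / 10) := by norm_num
  have e2 : Real.exp (-((1 - 1 / 10) * ((1 / 2 - 1 / 10) * δ₀) * g.dist y y')) = Real.exp (-(9 / 25 * δ₀ * g.dist y y')) := by
    congr 1; ring
  rw [e1, e2]

set_option maxHeartbeats 400000 in
/-- The same clause with [4] Lemma 2.1 (2.61) and the p. 398 scale transfer hypothesised «for every `0 < α < 1`» (the binder text of FILE 45
`B9Thm34SectBUniform.thm34_Cinv_uniform`), by restriction of those binders to the R1 window `9/5000 ≦ α`.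
[cite: Balaban1985BackgroundPropagators, Thm 3.4 p.400 + Thm 3.2 (3.48) p.398 + p.403; Balaban1984PropagatorsII, Lemma 2.1 p.234] -/
theorem thm34_Cinv_uniform_blk_pos [DecidableEq ι] (d : ℕ) (δ₀ κQ BG B₁ cF Cq a₀ d₀ M₂ : ℝ) (Λf : ℝ → ℝ)
    (hκQ : 0 < κQ) (hBG : 0 < BG) (hB₁ : 0 < B₁) (hcF : 0 < cF) (hCq : 0 ≤ Cq) (ha₀ : 0 ≤ a₀) (hM₂ : 0 ≤ M₂) (hδ₀ : 0 < δ₀)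
    (hΛf : ∀ α : ℝ, 0 < α → 1 ≤ Λf α) (hrepr : ∀ (v : 𝔸) (i : ι), |b.repr v i| ≤ M₂ * ‖v‖) :
    ∃ a₁ : ℝ, 0 < a₁ ∧
    ∀ {S : Type} [Fintype S] [DecidableEq S] (T : κ → Equiv.Perm S) (U : κ → S → 𝔸ˣ)
      {g : B9.Geometry} [Fintype g.Site] [DecidableEq g.Site] [Nonempty g.Site] {Rr : ℝ} {H : Prop} (blk : S → g.Site)
      {P : Type} [Fintype P] [DecidableEq P] (blkP : P → g.Site)
      (kQ : g.Site → S → 𝔸 →L[ℝ] 𝔸) (sQ : S → 𝔸 →L[ℝ] 𝔸) (cfun w : g.Site → ℝ),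
      (∀ a a' : g.Site, 0 ≤ g.dist a a') → Triangle254 (toB6 g Rr H) → (∀ y : g.Site, g.dist y y = 0) →
      (∀ y y' : g.Site, g.dist y y' = g.dist y' y) → (∀ y : g.Site, 0 < g.len y) → (∀ y : g.Site, g.eta ≤ g.len y) → 0 < g.eta →
      (∀ α : ℝ, 0 < α → α < 1 → Ineq261 d (toB6 g Rr H) δ₀ α) →
      (∀ α : ℝ, 0 < α → ScaleTransfer g δ₀ α (Λf α) (fun a => g.len a) ∧ ScaleTransfer g δ₀ α (Λf α) (fun a => g.len a ^ 2) ∧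
        ScaleTransfer g δ₀ α (Λf α) (fun a => (g.len a)⁻¹) ∧ ScaleTransfer g δ₀ α (Λf α) (fun a => (g.len a ^ 2)⁻¹) ∧
        ScaleTransfer g δ₀ α (Λf α) (fun a => (g.len a ^ 4)⁻¹) ∧ ScaleTransfer g δ₀ α (Λf α) (fun y => g.len y ^ (-(4 : ℝ)))) →
      (∀ m z, ‖((U m z : 𝔸ˣ) : 𝔸)‖ ≤ 1 ∧ ‖(((U m z)⁻¹ : 𝔸ˣ) : 𝔸)‖ ≤ 1) →
      (∀ μ x, g.dist (blk x) (blk ((T μ).symm x)) ≤ d₀) → (∀ μ x, g.dist (blk x) (blk (T μ x)) ≤ d₀) →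
      (∀ y : g.Site, g.dist y y ≤ d₀) →
      (∀ y, 0 ≤ w y) → (∀ y, ((B9Eq360Vprime.block blk y).card : ℝ) * w y ≤ 1) →
      (∀ y x, blk x = y → ‖kQ y x‖ ≤ w y) → (∀ x, ‖sQ x‖ ≤ 1) → (∀ y, |cfun y| ≤ a₀ * (g.len y ^ 2)⁻¹) →
    ∀ {Gp : Module.End ℝ (S × ι → ℝ)},
      HasMajorant (g := toB6 g Rr H) (fun p : S × ι => blk p.1) Gp (fun a a' => BG * g.len a ^ 2 * Real.exp (-(δ₀ * g.dist a a'))) →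
      (∀ k : κ ⊕ κ, HasMajorant (g := toB6 g Rr H) (fun p : S × ι => blk p.1)
        (conj b (diffLetter T U ((g.eta : ℂ)⁻¹) k) * Gp) (fun a a' => BG * g.len a * Real.exp (-(δ₀ * g.dist a a')))) →
    ∀ {Qc : (S × ι → ℝ) →ₗ[ℝ] (P → ℝ)} {Qcs : (P → ℝ) →ₗ[ℝ] (S × ι → ℝ)} {Linv : Module.End ℝ (P → ℝ)},
      HasMajorantHom (g := toB6 g Rr H) (fun p : S × ι => blk p.1) blkP Qc
        (fun a a' : g.Site => κQ * (if a = a' then (1 : ℝ) else 0)) →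
      HasMajorantHom (g := toB6 g Rr H) blkP (fun p : S × ι => blk p.1) Qcs
        (fun a a' : g.Site => κQ * (if a = a' then (1 : ℝ) else 0)) →
      (Qc ∘ₗ (Gp * Gp) ∘ₗ Qcs) * Linv = 1 →
      HasMajorant (g := toB6 g Rr H) blkP Linv (fun a a' => B₁ * g.len a ^ (-(4 : ℝ)) * Real.exp (-(δ₀ * g.dist a a'))) →
    ∀ (α₁ : ℝ), 0 ≤ α₁ → α₁ ≤ a₁ →
    ∀ (A : κ → S → 𝔸) (kF : g.Site → S → 𝔸 →L[ℝ] 𝔸) (sF : S → 𝔸 →L[ℝ] 𝔸),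
      (∀ y x, blk x = y → ‖kF y x‖ ≤ Cq * α₁ * w y) → (∀ x, ‖sF x‖ ≤ Cq * α₁) →
      (∀ ν k x, ‖((g.eta : ℂ)⁻¹) • covDstar T U ν (A k) x‖ ≤ α₁ * (g.len (blk x) ^ 2)⁻¹) →
      (∀ k x, ‖A k x‖ ≤ α₁ * (g.len (blk x))⁻¹) → (∀ ν k x, ‖tauB T U ν (A k) x‖ ≤ α₁ * (g.len (blk x))⁻¹) →
    ∀ {Qc' Fc : (S × ι → ℝ) →ₗ[ℝ] (P → ℝ)} {Qcs' Fcs : (P → ℝ) →ₗ[ℝ] (S × ι → ℝ)},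
      Qc' = Qc + Fc → Qcs' = Qcs + Fcs →
      HasMajorantHom (g := toB6 g Rr H) (fun p : S × ι => blk p.1) blkP Fc
        (fun a a' : g.Site => cF * α₁ * (if a = a' then (1 : ℝ) else 0)) →
      HasMajorantHom (g := toB6 g Rr H) blkP (fun p : S × ι => blk p.1) Fcs
        (fun a a' : g.Site => cF * α₁ * (if a = a' then (1 : ℝ) else 0)) →
    ∃ Tinv : Module.End ℝ (P → ℝ),
      Tinv * (Qc' ∘ₗ ((gPrimeExtEnd Gp (conj b (vPrimeConc T U g.eta A blk kQ kF sQ sF cfun) * Gp)) * (gPrimeExtEnd Gp (conj b (vPrimeConc T U g.eta A blk kQ kF sQ sF cfun) * Gp))) ∘ₗ Qcs') = 1 ∧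
      (Qc' ∘ₗ ((gPrimeExtEnd Gp (conj b (vPrimeConc T U g.eta A blk kQ kF sQ sF cfun) * Gp)) * (gPrimeExtEnd Gp (conj b (vPrimeConc T U g.eta A blk kQ kF sQ sF cfun) * Gp))) ∘ₗ Qcs') * Tinv = 1 ∧
      HasMajorant (g := toB6 g Rr H) blkP Tinv (fun a a' =>
        2 * B₁ * B6.c1 d (2 / 5 * δ₀) (1 / 10) * g.len a ^ (-(4 : ℝ)) * Real.exp (-(9 / 25 * δ₀ * g.dist a a'))) := by
  obtain ⟨a₁, ha₁, Hc⟩ := thm34_Cinv_uniform_blk b κ d δ₀ κQ BG B₁ cF Cq a₀ d₀ M₂ Λf hκQ hBG hB₁ hcF hCq ha₀ hM₂ hδ₀ hΛf hrepr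
  refine ⟨a₁, ha₁, ?_⟩
  intro S _ _ T U g _ _ _ Rr H blk P _ _ blkP kQ sQ cfun w hdnn htri hrefl hsym hlen hlenη hη h261 hST
  exact Hc T U blk blkP kQ sQ cfun w hdnn htri hrefl hsym hlen hlenη hη (fun α hα hα1 => h261 α (by linarith) hα1)
    (fun α hα => hST α (by linarith))

end CInv

end Literature.MathematicalPhysics.QuantumFieldTheory.Balaban1983to89.B9Thm34InvBlk

end
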